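import Literature.MathematicalPhysics.QuantumFieldTheory.Balaban1983to89.B7Eq125RightInverse
import Literature.MathematicalPhysics.QuantumFieldTheory.Balaban1983to89.B7Prop3GeneralTild
import Literature.MathematicalPhysics.QuantumFieldTheory.Balaban1983to89.B7Prop3GeneralLinearBound
import Literature.MathematicalPhysics.QuantumFieldTheory.Balaban1983to89.B7LocalityGeneral
import Literature.MathematicalPhysics.QuantumFieldTheory.Balaban1983to89.B9Eq332FieldAvgCovariance
import Literature.MathematicalPhysics.QuantumFieldTheory.Balaban1983to89.B10Eq61EliminationTerms
import Mathlib.MeasureTheory.Measure.Lebesgue.EqHaar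

/-!
# `Balaban1983to89.B10Eq61SpineCoefficient` — T. Bałaban, *Ultraviolet stability of three-dimensional lattice pure gauge
# field theories*, CMP **102** (1985) 255–275 [Balaban1985UV3], p. 271: «the coefficient at the variable A(b₀(c)) in
# (QA)(c)» — THE BOND `b₀(c)` OF [5] p. 428 IS THE SPINE BOND OF THE BLOCK; THE MATRIX «coefficient of A(b₀(c′)) in
# (QA)(c)» IS BLOCK-DIAGONAL OVER THE COARSE BONDS c (from the LOCALITY of the averaging, [4] p. 24); AND FOR THE MAIN
# TERM (125) OF [4] THE BLOCK IS `S₀(V₀, b₀(c)) = L^{−d}·R(V₀([c₋, b₀(c)₋]))`, A SCALAR MULTIPLE OF A ROTATION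

statement-level skeleton of published theorems with citation tags; proofs where landed; nothing here is a claim
about the Yang–Mills mass gap

SOURCES (renders READ AS IMAGES by this seat, 2026-08-22: `b2b-balaban-ref1/pages/1985-cmp102-uv-stability-3d/…-p017-x2.png`,
`…/1985-cmp99-background-propagators/…-p040-x2.png`, `…/1985-cmp98-averaging/…-p020-x2.png`; journal page = PDF page
+ 254 for [B10], + 388 for [5], + 16 for [4]).
* [Balaban1985UV3] (= B10) p. 271, after (62), verbatim: *"We eliminate the δ-functions and we write the integral in
  terms of the independent variables Ã introduced at the beginning of Sect. E [5]. They are connected with A by the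
  simple linear operator C described there, A = CÃ … The elimination yields also a sum of local terms determined by
  the coefficient at the variable A(b₀(c)) in (QA)(c). More exactly the coefficient is a linear operator
  S(V_k^{(k)}, b₀(c)) acting on the Lie algebra 𝔤, see the formula (124) [4] for a precise definition, and we obtain
  the sum of terms −log det S(V_k^{(k)}, b₀(c)). They are simple, local, gauge invariant functions of V_k^{(k)} =
  Ū_{k+1}^k"*.
* [Balaban1985BackgroundPropagators] (= [5] of B10 = B9), p. 428 [PDF 40], verbatim: *"These are variables B restricted
  to the set of bonds Λ̃ = Λ∖(⋃_{y∈Λ′}Ax(y) ∪ ⋃_{c∈Λ′}B(c)∩c). Let us recall that B(c) = {bonds b connecting blocks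
  B(c₋), B(c₊), i.e. bonds b such that b₋ ∈ B(c₋), b₊ ∈ B(c₊)}, hence B(c)∩c consists of the exactly one bond b₀ of
  B(c) contained in c. Variables B depend linearly on B̃ and we have B = CB̃, where C is a linear operator. It is an
  identity operator on almost all bonds, except the bonds b₀ for which a value (CB̃)(b₀) is equal to a solution of the
  equation (QB)(c) = 0, considered as an equation on the variable B(b₀)."*
* [Balaban1985Averaging] (= [4] of B10 = B7), p. 36 [PDF 20]: (121) *"Q(V₀, A, c) = (1/i) log(V̿₁)_c"*, (122)
  *"Q(V₀, A, c) = L(Q(V₀)A)_c + C(V₀, A, c)"*, (124) = the five-term linear form, (125) *"(Q₀A)_c = (Q_{V₀}A)_c =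
  Σ_{x∈B(c₋)} L^{−(d+1)}(R_{0,c₋}A)([x, x′])"* («the main term in this linear form»); p. 24 (after (43)): *"this
  definition is local in the sense that Ū^k_c, c ⊂ Ω^{(k)}, depends only on the bond variables U_b for b ⊂ B^k(c₋) ∪
  B^k(c₊)"*; p. 34: *"(V̿₁)_c is an analytic function of the variables A_b, b ⊂ B(c₋) ∪ B(c₊)"*.

WHAT THE TREE HAD (all REUSED BY NAME, nothing restated or modified).  The pub-balaban NE9 lineage's
`B7Eq125RightInverse` (`corner L y = L·y`, `blk`, `spineSite L κ y = L·y + (L−1)e_κ` — «the spine bond», the section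
`secCfg` supported on the spine bonds and the EXACT RIGHT INVERSE `Q0cov_secCfg : Q₀(V₀)(S w)(L·y, κ) = w(y, κ)` of the
main term (125) `B7Prop3GeneralLinear.Q0cov`); NE7c's `B7Prop3GeneralTild.tsum_add` (the rotated functional (58) is additive in the field); r20's `B7LocalityGeneral.Qcov_congr` (LOCALITY of the one-step map (121)
`B7Prop3GeneralLinear.Qcov` — and hence of its linear part `linQcov` (122) — in the box `[q, q + (L−1)𝟙 + Le_κ] =
B(c₋) ∪ B(c₊)` of b07's `B7Prop1Local.bondHi`); `B8Ineq132.norm_conjR` (the rotations `R(u)`, `u ∈ U1`, are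
isometries); pv-lineage's `B9Eq332FieldAvgCovariance.linQcov_rot` ((3.32) of [5] for the linear part (122): `(Q(V₀^u)R(u)A)_c =
R(u(c₋))(Q(V₀)A)_c`) [v1.1]; NE7c's `B7Prop3GeneralTild.linQcov_add` / `linQcov_smul` (the linear part (122) IS linear in the
field when the block loops satisfy `‖W_x(V₀) − 1‖ < 1`) and `B7Prop3GeneralLinearBound.norm_linQcov_sub_main_le` (the explicit (126):
`‖L(Q(V₀)A)_c − L·(Q₀A)_c‖ ≤ 50(d+1)·ε·L·|A|`), b07's `B7Prop2Explicit.norm_Wcx_sub_one_le` (Proposition 1: plaquette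
regularity (44)/(109) ⇒ block loops within `16(d+1)(d+4)L²α₀` of `1`) [v1.2]; Mathlib's
`MeasureTheory.Measure.addHaar_image_linearMap` (`μ(T·s) = |det T|·μ(s)`), `LinearMap.det_smul` / `det_comp` /
`det_toMatrix`, and b07's `B7Prop1Explicit.Wcx_gaugeAct` (the block loop is conjugated under (8)) [v1.3]; the audit
cell's `Beta.ConstraintElimination.abs_det_smul_of_transpose_mul_self_eq_one` (whose docstring
says *"e.g. a scalar times the adjoint action of a group element in a tr-orthonormal basis of 𝔤 … Whether Bałaban's
coefficient has this shape is NOT asserted here"*) and `abs_det_blockDiagonal`; this seat's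
`B10Eq61EliminationTerms.logZ_sub_logZ_eq_of_abs_det_eq` ((61) = the Gaussian bracket when the elimination Jacobian is
background-free; its block hypothesis `hS` = HONEST SCOPE (i) there: «the objects (Q of [5], b₀(c)) the tree does not
construct»).

DICTIONARY print ↦ Lean (b07/NE9 conventions: the fine lattice is `ℤ^d` (`Site d`), bonds `(x, μ) = ⟨x, x + e_μ⟩`,
configurations `Site d → Fin d → 𝔸`, blocks `B(L·y) = [L·y, L·y + (L−1)𝟙]` = `{x : blk L x = y}`, the coarse bond
`c = ⟨L·y, L·y + Le_κ⟩ ↦ (corner L y, κ)`, `R(X)Y = XYX⁻¹` = `conjR`):  `b₀(c)` ↦ the bond `(spineSite L κ y, κ)`;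
«the coefficient at the variable A(b₀(c′)) in (QA)(c)» ↦ the dependence of `Qcov L V₀ A (corner L y) κ` (121) /
`linQcov` (122) / `Q0cov` (125) on the value `A (spineSite L κ′ y′) κ′`; `S₀(V₀, b₀(c))` ↦ `mainCoeff L V₀ y κ :=
X ↦ L^{−d}·R(V₀([L·y, L·y + (L−1)e_κ]))X` (THE MAIN-TERM BLOCK; print's `S(V, b₀(c))` is read off the FULL linear form
(124), of which (125) is «the main term» — see HONEST SCOPE); [v1.1] the `b₀(c)`-coefficient of the FULL linear part (122)
↦ `fullCoeff L V₀ y κ := X ↦ linQcov L V₀ (bondField (spineSite L κ y) κ X) (corner L y) κ` (= `L·S(V₀, b₀(c))` in the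
reading C-adv4-22 of (122), «L(Q(V₀)A)_c» = `L·`(124)).

WHAT THIS FILE PROVES (kernel, 0 sorry, standard axioms; three definitions with bodies — `spinePart`, `offSpinePart`,
`mainCoeff` — (+ [v1.1] `bondField`, `fullCoeff`; [v1.3] `conjROn`, `mainCoeffOn`, `fullCoeffOn`), no `def … : Prop`,
no fact of the papers asserted as a hypothesis-free claim beyond what is derived):
* §1 `b₀(c)` IS THE SPINE BOND: `corner_add_e`, `blk_spineSite`, `blk_spineSite_add_e` (the spine bond starts in
  `B(c₋)` and ends in `B(c₊)`), **`b0_iff`** (among the `L` bonds of `c` the one with `b₋ ∈ B(c₋)`, `b₊ ∈ B(c₊)` is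
  exactly the last one, `j = L − 1`) — [5] p. 428's definition pinned to NE9's `spineSite`.
* §2 BLOCK-DIAGONALITY FROM LOCALITY: `blk_of_inBox_pair` (the box `B(c₋) ∪ B(c₊)` is the union of the two blocks),
  **`spine_in_box`** (the only spine bond with both endpoints in `B(c₋) ∪ B(c₊)` is `b₀(c)`), `agreeOn_of_offSpine`,
  **`Qcov_eq_of_offSpine`** / **`linQcov_eq_of_offSpine`** (two fields that agree off the spine bonds and at `b₀(c)`
  give the same `Q(V₀, ·, c)` (121) and the same linear part (122): NO DEPENDENCE on `A(b₀(c′))`, `c′ ≠ c` — the matrix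
  «coefficient of A(b₀(c′)) in (QA)(c)» is block-diagonal over `c`, which is the shape `hS` of
  `B10Eq61EliminationTerms` on the B7 carrier), `Qcov_spine_local` (the same, phrased for a perturbation supported on
  the spine bonds).
* §3 THE MAIN-TERM BLOCK: `Q0cov_add_cfg` ((125) is additive in `A`; NE7c's `B7Prop3GeneralTild.tsum_add` by name), `spinePart`/`offSpinePart`
  (+ `spinePart_add_offSpinePart`, `spinePart_eq_secCfg`: the spine part of any `A` IS NE9's section of the coarse
  field `w(y, κ) = L^{−d}R(V₀([L·y, b₀₋]))A(b₀(c))`), **`Q0cov_spinePart`** (`(Q₀ A_spine)(c) = S₀(V₀, b₀(c)) A(b₀(c))`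
  — depends on the spine variables through `A(b₀(c))` ALONE, with the block `mainCoeff`), **`Q0cov_eq_mainCoeff_add`**
  (`(Q₀A)(c) = S₀(V₀, b₀(c))A(b₀(c)) + (Q₀A_offspine)(c)` — «the coefficient at the variable A(b₀(c))» of the main term,
  exact for EVERY background), `mainCoeff_one` (at `V₀ = 1`: `S₀ = L^{−d}·id`), **`norm_mainCoeff`** (`‖S₀X‖ =
  L^{−d}‖X‖` for `V₀` in `U1`: a scalar multiple of an ISOMETRY), `mainCoeff_injective` ([5] p. 428 «considered as an
  equation on the variable B(b₀)»: for the main term the equation is uniquely solvable — cf. NE9's right inverse).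
* §4 THE DETERMINANT OF A SCALED ISOMETRY (linear algebra, [folklore]): `toMatrix_transpose_mul_self_eq_one_of_inner`
  (in an orthonormal basis an inner-product-preserving map has an orthogonal matrix), **`abs_det_toMatrix_smul_of_inner`**
  (`|det [t·T]| = |t|^{dim}`) — so a block of the form «`L^{−d}` × (Ad-isometry of 𝔤 for an Ad-invariant inner product,
  e.g. the trace form (17) of [4])» has `|det| = L^{−d·dim 𝔤}`, independent of the background: the audit cell's
  criterion is MET by the main-term block.
* §5 CONSEQUENCE FOR (61) (by name from `B10Eq61EliminationTerms`): `sum_log_abs_det_eq_of_shape`,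
  `abs_det_eq_of_shape`, **`logZ_sub_logZ_eq_of_mainTerm_shape`** — if every elimination block of
  both backgrounds has the main-term shape `t·O_c`, `O_cᵀO_c = 1` (same `t = L^{−d}`), the local terms
  `−Σ_c log|det S_c|` are the SAME constant for `U_{k+1}` and for `1` and drop out of (61): (61) is exactly the Gaussian
  bracket.
* §6 [v1.1] GAUGE COVARIANCE OF THE MAIN-TERM BLOCK: **`mainCoeff_gaugeAct`** (`S₀(V₀^u, b₀(c)) = R(u(c₋)) ∘ S₀(V₀, b₀(c))
  ∘ R(u(b₀(c)₋))⁻¹` under the gauge transformation (8) of [4], by `hol_gaugeAct`), `conjR_inv_mainCoeff_gaugeAct`,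
  `norm_mainCoeff_gaugeAct`.
* §7 [v1.1] THE `b₀(c)`-COEFFICIENT OF THE FULL LINEAR PART (122): defs `bondField` (one Lie-algebra variable on one bond),
  **`fullCoeff`** (the directional derivative of (121) at `0` along the `b₀(c)`-variable = the `b₀(c)`-column of «L(Q(V₀)·)_c»);
  **`fullCoeff_gaugeAct`** / `fullCoeff_gaugeAct'` (`S(V₀^u, b₀(c)) = R(u(c₋)) ∘ S(V₀, b₀(c)) ∘ R(u(b₀(c)₋))⁻¹` — by name
  from `B9Eq332FieldAvgCovariance.linQcov_rot`: print's «gauge invariant functions of V_k^{(k)}» for the ACTUAL coefficient,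
  every conjugation-invariant function of the block being gauge invariant), `linQcov_bondField_add_offBlock` (block-diagonality
  restated: the other eliminated variables do not enter), `Q0cov_zero_cfg`, `Q0cov_bondField` (the main term of the full
  coefficient IS §3's `mainCoeff`), **`fullCoeff_one`** (flat background: `S(1, b₀(c)) = L·L^{−d}·id`, by name from
  `linQcov_one_left` + `B7Prop3Flat.linQ_eq_smul_Q0form`).
* §8 [v1.2] INVERTIBILITY OF THE FULL COEFFICIENT AT A REGULAR BACKGROUND ([5] p. 428 «considered as an equation on the
  variable B(b₀)»): `bondField_add` / `bondField_smul` / `norm_bondField_le`, **`fullCoeff_add`** / `fullCoeff_smul` /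
  `fullCoeff_sub` (the full coefficient IS linear when the block loops satisfy `‖W_x(V₀) − 1‖ < 1`, by `linQcov_add`/`_smul`),
  **`norm_fullCoeff_sub_smul_mainCoeff_le`** (`‖S(V₀, b₀(c))X − L·S₀(V₀, b₀(c))X‖ ≤ 50(d+1)·ε·L·‖X‖` — the explicit (126) on
  the single-bond field), **`norm_fullCoeff_ge`** (`‖S(V₀, b₀(c))X‖ ≥ L(L^{−d} − 50(d+1)ε)‖X‖`), **`fullCoeff_injective`**
  (`50(d+1)ε < L^{−d}` ⇒ `S(V₀, b₀(c))` injective: the `b₀`-equation has at most one solution for the ACTUAL linear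
  constraint; = `det S ≠ 0` on the finite-dimensional 𝔤), **`fullCoeff_injective_of_plaquette`** (the same from the plaquette
  regularity (44)/(109) `|V₀(∂p) − 1| ≤ α₀` with `512(d+1)(d+4)L²α₀ ≤ 1`, `800(d+1)²(d+4)L²α₀ < L^{−d}` — an explicit
  «c₃ depends on d and L» of Proposition 3).
* §9 [v1.3] THE DETERMINANT ON AN `Ad`-STABLE FINITE-DIMENSIONAL `𝔤 ⊂ 𝔸` (print: «a linear operator S(V_k^{(k)}, b₀(c))
  acting on the Lie algebra 𝔤 … −log det S»): **`abs_det_eq_one_of_norm_map`** ([folklore], by Haar measure: a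
  norm-preserving linear endomorphism of a finite-dimensional real normed space has `|det| = 1` — for ANY norm, so §3's
  algebra-norm isometry suffices and §4's inner product is not needed), `abs_det_smul_of_norm_map`,
  `abs_det_conj_of_norm_map`; defs `conjROn` (`R(u)|_𝔤`, cf. r10's `B13HaarSigmaJacobian.Adg` on the matrix carrier) and
  **`mainCoeffOn`** (`S₀(V₀, b₀(c))|_𝔤`; [v1.5] for backgrounds with values in ANY subgroup `H ≤ U1 𝔸` under whose
  rotations `𝔤` is stable — print's gauge group `G` and its Lie algebra, second reader's note L-33);
  **`abs_det_mainCoeffOn`** (`|det S₀(V₀, b₀(c))|_𝔤 = L^{−d·dim 𝔤}` for EVERY such background and every finite-dimensional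
  real `𝔤` stable under the rotations of `H` — HONEST SCOPE (iii)'s `hT` DISCHARGED), `abs_det_mainCoeffOn_eq` (background-free), `neg_log_abs_det_mainCoeffOn` (the main-term local term is the
  constant `d·dim 𝔤·log L`), `abs_det_toMatrix_mainCoeffOn`, `abs_det_eq_of_blocks`,
  **`logZ_sub_logZ_eq_of_mainCoeffOn_blocks`** (§5's (61)-consequence with the shape hypotheses `h₁`/`h₀` REPLACED by «the
  blocks are the matrices, in a basis of 𝔤, of `S₀(U_{k+1}, b₀(c))`, `S₀(1, b₀(c))`»); §9c `norm_Wcx_gaugeAct_sub_one` (the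
  block-loop regularity is gauge invariant, (45) of [4]), `fullCoeff_gaugeAct_mem`, def **`fullCoeffOn`** (the FULL
  coefficient on 𝔤 at a regular background, under the HYPOTHESIS `h𝔤` that it maps 𝔤 into 𝔤), `fullCoeffOn_gaugeAct`,
  **`abs_det_fullCoeffOn_gaugeAct`** / `neg_log_abs_det_fullCoeffOn_gaugeAct` (`|det S(V₀^u, b₀(c))|_𝔤 = |det S(V₀, b₀(c))|_𝔤`
  for `U1`-valued gauge transformations: the local term `−log|det S(V_k^{(k)}, b₀(c))|` of the ACTUAL coefficient IS a
  «gauge invariant function of V_k^{(k)}», p. 271).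
* §9d [v1.4] ON `𝔤` THE `b₀(c)`-EQUATION IS UNIQUELY SOLVABLE AND `det S ≠ 0` ([5] p. 428 «a solution of the equation
  (QB)(c) = 0, considered as an equation on the variable B(b₀)»; second reader's note L-32 (e)/(f)): `fullCoeffOn_injective`,
  **`fullCoeffOn_bijective`** (finite dimension: injective ⇒ surjective — the solution EXISTS and is unique),
  `fullCoeffOn_existsUnique`, **`det_fullCoeffOn_ne_zero`** (the standing hypothesis `hκ`/`hS0` of `B10Eq61EliminationTerms`
  DISCHARGED for the actual coefficient at a regular background, modulo the `S`-stability hypothesis `h𝔤`),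
  `abs_det_fullCoeffOn_pos`, `fullCoeff_injective_of_c3` (ONE explicit window `α₀ < L^{−(d+2)}/(800(d+1)²(d+4))` — an explicit
  «c₃ depends on d and L» of Proposition 3 — implies both conditions of `fullCoeff_injective_of_plaquette`).

HONEST SCOPE.  (i) Print's `S(V_k^{(k)}, b₀(c))` is the `b₀(c)`-coefficient of the FULL linear form (124) (main term
(125) + four correction terms carrying the operators `g(−i ad_Y)`, `g⁻¹(∓i ad_{Y_x})`, `e^{±i ad_Y}`, «estimated by
O(L²α₀)»); §2 (block-diagonality) is proved for the full one-step map (121) and its linear part (122), hence covers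
(124); §3–§5 compute the block ONLY for the main term (125) — for the full (124) the block is `S₀·(1 + O(L²α₀))` and
DOES depend on the background, as print says («simple, local, gauge invariant functions of V_k^{(k)}»); nothing here
claims the full Jacobian bracket vanishes; [v1.1] §7 DEFINES the full coefficient (as the `b₀(c)`-directional derivative of
(121)) and proves its GAUGE COVARIANCE and its flat value — its value at a curved background beyond the main term ((124)'s
correction operators) is NOT computed, and the linearity of «L(Q(V₀)·)_c» in the field (needed to call `fullCoeff` a
«coefficient» of a linear map rather than a directional derivative) holds at a background with block loops `‖W_x(V₀) − 1‖ < 1`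
(NE7c's `linQcov_add`; [v1.2] `fullCoeff_add`); [v1.2] §8's invertibility is INJECTIVITY on the algebra 𝔸 at a regular
background — «det S(V_k^{(k)}, b₀(c)) ≠ 0» proper needs the restriction to the finite-dimensional 𝔤 ⊂ 𝔸 (Ad- and
`S`-invariant), not typed here ([v1.3]: the restriction is §9's `fullCoeffOn`, under the `S`-invariance HYPOTHESIS `h𝔤`;
[v1.4]: on it `det S(V₀, b₀(c)) ≠ 0` and the `b₀(c)`-equation is uniquely solvable, §9d `det_fullCoeffOn_ne_zero` /
`fullCoeffOn_bijective`); positivity / sign of det S is NOT asserted (ref-5's DECLARED DIVERGENCE on the |det| reading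
of `B10Eq61EliminationTerms` stands).  (ii) `ℤ^d` carrier of the b07/NE9 lineage, one averaging step (the
`k`-fold composite `Q_k` of (127) and the torus are not treated here; cf. `B7LocalityGeneral.logCovIter_congr`,
`B7AvgPeriodicity`).  (iii) The identification of 𝔤 ⊂ 𝔸 with a real inner-product space on which `R(u)` acts
isometrically (Ad-invariance of the trace form) enters §4 as the HYPOTHESIS `hT`; §3's `norm_mainCoeff` is the
isometry for the algebra norm — [v1.3] §9 REMOVES this hypothesis: by `abs_det_eq_one_of_norm_map` (any norm) the
algebra-norm isometry suffices, and `|det S₀(V₀, b₀(c))|_𝔤 = L^{−d·dim 𝔤}` holds on every finite-dimensional real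
subspace `𝔤 ⊂ 𝔸` stable under the rotations `R(u)`, `u ∈ U1` (`abs_det_mainCoeffOn`); what stays a hypothesis is the
`S`-stability of `𝔤` for the FULL coefficient (`h𝔤` of `fullCoeffOn`: in print a consequence of the group-valuedness of
the averaging (121), not typed on the abstract `𝔸`), and the sign of `det` (only `|det|` is treated); [v1.5, second
reader's L-33] the `Ad`-stability hypothesis `hst` and the value constraints `hV₀` / `hu` range over an arbitrary subgroup
`H ≤ U1 𝔸` (print's gauge group `G ⊂ U(N)`; b07's `B7Prop2Explicit.hol_mem_of` keeps the transporters in `H`): for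
`𝔸 = M_N(ℂ)` with the operator norm this covers `𝔲(N)`, `𝔰𝔲(N)` (`H = U(N)`) as well as `𝔰𝔬(N)`, `𝔰𝔭(n)` (`H = SO(N)`,
`Sp(n)`), whose Lie algebras are only `Ad(G)`-stable (v1.3/v1.4 had `H = U1 𝔸`).
(iv) KIND (G.5-54 [i]): derived members / dictionary over the lineage's concrete
objects; no print provenance is claimed for the value `L^{−d}·R(V₀([c₋, b₀(c)₋]))`, which print does not display.
Row B10.Eq61 member; B10.Eq17 / B10.Eq63 (leaf E63 → X13 «(124) [4]») cross-references.  Unit `lit-balaban-r07` gen 35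
(v1; v1.1 = v1 + §6–§7 APPEND-ONLY + one import, every v1 declaration unchanged; v1.2 = v1.1 + §8 APPEND-ONLY + one
import, every v1.1 declaration unchanged; v1.3 = v1.2 + §9 APPEND-ONLY + one Mathlib import
(`MeasureTheory.Measure.Lebesgue.EqHaar`), every v1.2 declaration unchanged; v1.4 = v1.3 + §9d APPEND-ONLY, every v1.3
declaration unchanged; v1.5 = v1.4 with §9–§9c GENERALISED IN PLACE from `U1 𝔸` to a subgroup `H ≤ U1 𝔸` — the signatures of
`mainCoeffOn`, `mainCoeffOn_apply`, `abs_det_mainCoeffOn(_eq)`, `neg_log_abs_det_mainCoeffOn`, `abs_det_toMatrix_mainCoeffOn`,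
`logZ_sub_logZ_eq_of_mainCoeffOn_blocks`, `fullCoeff_gaugeAct_mem`, `fullCoeffOn_gaugeAct`, `(neg_log_)abs_det_fullCoeffOn_gaugeAct`
gain `{H : Subgroup 𝔸ˣ}` / `(hH : H ≤ U1 𝔸)`; the v1.3/v1.4 statements are the case `H = U1 𝔸`, `hH = le_rfl`; no consumer of the
v1.3 signatures existed; every other declaration unchanged).
-/

noncomputable section

open scoped BigOperators Matrix
open Finset

namespace Literature.MathematicalPhysics.QuantumFieldTheory.Balaban1983to89.B10Eq61SpineCoefficient

open B7Prop1Explicit B7Prop3GeneralRotated B7Prop3GeneralLinear B7Eq125RightInverse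
open B7Eq78Linearization (conjR conjR_apply conjR_add conjR_smul conjR_smul_real)
open B8Ineq132 (conjR_conjR one_conjR norm_conjR)
open B7Prop1Local (InBox AgreeOn bondHi add_zsmul_e_apply add_e_apply)

-- `Site` alone would resolve to the torus sites of `Setup.lean`; re-export the `ℤ^d` sites of `B7Prop1Explicit`.
export B7Prop1Explicit (Site)

variable {d : ℕ}

/-! ## §1 `b₀(c)` is the spine bond ([5] p. 428) -/

section SpineBond

variable {L : ℕ}

/-- components of `n·e_κ`. [folklore] -/
private theorem zsmul_e_apply (n : ℤ) (κ i : Fin d) : (n • e κ : Site d) i = if i = κ then n else 0 := by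
  simp only [Pi.smul_apply, e_apply, smul_eq_mul, mul_ite, mul_one, mul_zero]

variable (L) in
/-- `L·(y + e_κ) = L·y + Le_κ`: the corner of the next block `B(c₊)` (block bookkeeping of (2) of [4]). [cite: Balaban1985Averaging, (2) p.17] -/
theorem corner_add_e (y : Site d) (κ : Fin d) : corner L (y + e κ) = corner L y + (L : ℤ) • e κ := by
  funext i
  simp only [corner_apply, Pi.add_apply, zsmul_e_apply, e_apply, mul_add, mul_ite, mul_one, mul_zero]

/-- The spine site `L·y + (L−1)e_κ` lies in the block `B(L·y)`: `b₀(c)₋ ∈ B(c₋)`. [cite: Balaban1985BackgroundPropagators, p.428 (after (3.156))] -/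
theorem blk_spineSite (hL : 1 ≤ L) (κ : Fin d) (y : Site d) : blk L (spineSite L κ y) = y := by
  unfold spineSite
  refine blk_corner_add hL y _ fun i => ?_
  rw [zsmul_e_apply]
  split_ifs <;> omega

/-- The head `L·y + Le_κ` of the spine bond lies in the next block `B(L·(y + e_κ))`: `b₀(c)₊ ∈ B(c₊)`. [cite: Balaban1985BackgroundPropagators, p.428 (after (3.156))] -/
theorem blk_spineSite_add_e (hL : 1 ≤ L) (κ : Fin d) (y : Site d) :
    blk L (spineSite L κ y + e κ) = y + e κ := by
  have h : spineSite L κ y + e κ = corner L (y + e κ) + 0 := by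
    rw [corner_add_e, add_zero, spineSite, add_assoc, add_right_inj]
    funext i
    rw [Pi.add_apply, zsmul_e_apply, zsmul_e_apply, e_apply]
    split_ifs <;> omega
  rw [h]
  exact blk_corner_add hL _ _ fun i => by simp; omega

/-- **`b₀(c)` = THE SPINE BOND.**  [5] p. 428: *"B(c) = {bonds b connecting blocks B(c₋), B(c₊), i.e. bonds b such that
b₋ ∈ B(c₋), b₊ ∈ B(c₊)}, hence B(c)∩c consists of the exactly one bond b₀ of B(c) contained in c"* — for the coarse
bond `c = ⟨L·y, L·y + Le_κ⟩`, whose fine bonds are `⟨L·y + je_κ, L·y + (j+1)e_κ⟩`, `j < L`, the condition «`b₋ ∈ B(c₋)`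
and `b₊ ∈ B(c₊)`» holds iff `j = L − 1`, i.e. iff the bond is NE9's spine bond `(spineSite L κ y, κ)`.
[cite: Balaban1985BackgroundPropagators, p.428 (after (3.156))] -/
theorem b0_iff (hL : 1 ≤ L) (y : Site d) (κ : Fin d) {j : ℕ} (hj : j < L) :
    (blk L (corner L y + (j : ℤ) • e κ) = y ∧ blk L (corner L y + (j : ℤ) • e κ + e κ) = y + e κ) ↔ j = L - 1 := by
  have hin : blk L (corner L y + (j : ℤ) • e κ) = y :=
    blk_corner_add hL y _ fun i => by rw [zsmul_e_apply]; split_ifs <;> omega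
  constructor
  · rintro ⟨-, h2⟩
    by_contra hne
    have hj1 : j + 1 < L := by omega
    have hin' : blk L (corner L y + (j : ℤ) • e κ + e κ) = y := by
      rw [add_assoc]
      refine blk_corner_add hL y _ fun i => ?_
      rw [Pi.add_apply, zsmul_e_apply, e_apply]
      split_ifs <;> omega
    have := congr_fun (hin'.symm.trans h2) κ
    rw [add_e_apply, if_pos rfl] at this
    omega
  · intro h
    subst h
    refine ⟨hin, ?_⟩
    have : corner L y + (((L - 1 : ℕ) : ℤ)) • e κ = spineSite L κ y := by
      rw [spineSite, Nat.cast_sub hL, Nat.cast_one]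
    rw [this]
    exact blk_spineSite_add_e hL κ y

/-- the spine site written as `corner + (L−1)e_κ` with a natural-number cast (bookkeeping for `b0_iff`). [cite: Balaban1985Averaging, (125) p.36] -/
theorem spineSite_eq (hL : 1 ≤ L) (κ : Fin d) (y : Site d) :
    spineSite L κ y = corner L y + (((L - 1 : ℕ) : ℤ)) • e κ := by
  rw [spineSite, Nat.cast_sub hL, Nat.cast_one]

end SpineBond

/-! ## §2 Block-diagonality over `c` from the locality of the averaging ([4] p. 24) -/

section Locality

variable {L : ℕ}

/-- **The box `B(c₋) ∪ B(c₊) = [L·y, L·y + (L−1)𝟙 + Le_κ]` is the union of the two blocks**: a site of the box has block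
index `y` or `y + e_κ`. [cite: Balaban1985Averaging, p.24 (sentence after (43))] -/
theorem blk_of_inBox_pair (hL : 1 ≤ L) (y : Site d) (κ : Fin d) {w : Site d}
    (hw : InBox (corner L y) (bondHi L (corner L y) κ) w) : blk L w = y ∨ blk L w = y + e κ := by
  set s : Site d := w - corner L y with hs
  have hw' : w = corner L y + s := by rw [hs, add_sub_cancel]
  have h0 : ∀ i, 0 ≤ s i ∧ s i ≤ ((L : ℤ) - 1) + if i = κ then (L : ℤ) else 0 := fun i => by
    have := hw i
    simp only [bondHi, hs, Pi.sub_apply] at this ⊢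
    constructor <;> omega
  by_cases hκ : s κ < L
  · left
    rw [hw']
    refine blk_corner_add hL y s fun i => ⟨(h0 i).1, ?_⟩
    by_cases hi : i = κ
    · subst hi; exact hκ
    · have := (h0 i).2; rw [if_neg hi] at this; omega
  · right
    have hw'' : w = corner L (y + e κ) + (s - (L : ℤ) • e κ) := by
      rw [corner_add_e, hw']; abel
    rw [hw'']
    refine blk_corner_add hL _ _ fun i => ?_
    rw [Pi.sub_apply, zsmul_e_apply]
    have := h0 i
    by_cases hi : i = κ
    · subst hi; rw [if_pos rfl] at this ⊢; omega
    · rw [if_neg hi] at this ⊢; omega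

/-- `e_μ = e_κ` only for `μ = κ`. [folklore] -/
private theorem e_eq_e_iff (μ κ : Fin d) : (e μ : Site d) = e κ ↔ μ = κ := by
  refine ⟨fun h => ?_, fun h => by rw [h]⟩
  have := congr_fun h μ
  rw [e_apply, e_apply, if_pos rfl] at this
  by_contra hne
  rw [if_neg hne] at this
  exact one_ne_zero this

/-- **THE ONLY SPINE BOND INSIDE `B(c₋) ∪ B(c₊)` IS `b₀(c)`**: if both endpoints of the spine bond
`⟨L·y′ + (L−1)e_μ, L·y′ + Le_μ⟩` lie in the box `[L·y, L·y + (L−1)𝟙 + Le_κ]` of `c = ⟨L·y, L·y + Le_κ⟩`, then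
`y′ = y` and `μ = κ` — the spine bonds of the neighbouring coarse bonds leave the box (their heads lie in blocks other
than `B(c₋)`, `B(c₊)`).  This is the combinatorial heart of print's «local terms … determined by the coefficient at the
variable A(b₀(c)) in (QA)(c)»: `(QA)(c)` sees no other eliminated variable.
[cite: Balaban1985UV3, p.271 (after (62)); Balaban1985Averaging, p.24 (after (43))] -/
theorem spine_in_box (hL : 1 ≤ L) (y y' : Site d) (κ μ : Fin d)
    (h1 : InBox (corner L y) (bondHi L (corner L y) κ) (spineSite L μ y'))
    (h2 : InBox (corner L y) (bondHi L (corner L y) κ) (spineSite L μ y' + e μ)) : y' = y ∧ μ = κ := by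
  have hx : blk L (spineSite L μ y') = y' := blk_spineSite hL μ y'
  have hx' : blk L (spineSite L μ y' + e μ) = y' + e μ := blk_spineSite_add_e hL μ y'
  have hne : (e μ : Site d) ≠ 0 := fun h => by
    have := congr_fun h μ; rw [e_apply, if_pos rfl] at this; exact one_ne_zero this
  rcases blk_of_inBox_pair hL y κ h1 with ha | ha <;> rcases blk_of_inBox_pair hL y κ h2 with hb | hb
  · -- y' = y, y' + e μ = y : impossible
    rw [hx] at ha; rw [hx', ha] at hb
    exact absurd (add_eq_left.1 hb) hne
  · -- y' = y, y' + e μ = y + e κ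
    rw [hx] at ha; rw [hx', ha, add_right_inj, e_eq_e_iff] at hb
    exact ⟨ha, hb⟩
  · -- y' = y + e κ, y' + e μ = y : impossible (κ-coordinate)
    rw [hx] at ha; rw [hx', ha, add_assoc, add_eq_left] at hb
    have := congr_fun hb κ
    rw [Pi.add_apply, e_apply, e_apply, if_pos rfl, Pi.zero_apply] at this
    split_ifs at this <;> omega
  · -- y' = y + e κ, y' + e μ = y + e κ : impossible
    rw [hx] at ha; rw [hx', ha, add_eq_left] at hb
    exact absurd hb hne

variable {𝔸 : Type*}

/-- Two fields that agree OFF the spine bonds and AT `b₀(c)` agree on every bond of the box `B(c₋) ∪ B(c₊)`. [cite: Balaban1985Averaging, p.24 (after (43)); Balaban1985BackgroundPropagators, p.428] -/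
theorem agreeOn_of_offSpine (hL : 1 ≤ L) (y : Site d) (κ : Fin d) {A A' : Site d → Fin d → 𝔸}
    (hoff : ∀ z μ, z ≠ spineSite L μ (blk L z) → A z μ = A' z μ)
    (hb0 : A (spineSite L κ y) κ = A' (spineSite L κ y) κ) :
    AgreeOn (corner L y) (bondHi L (corner L y) κ) A A' := by
  intro z μ hz hzμ
  by_cases hsp : z = spineSite L μ (blk L z)
  · obtain ⟨hy, hμ⟩ := spine_in_box hL y (blk L z) κ μ (hsp ▸ hz) (hsp ▸ hzμ)
    subst hμ
    rw [hsp, hy]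
    exact hb0
  · exact hoff z μ hsp

variable [NormedRing 𝔸] [NormedAlgebra ℂ 𝔸] [CompleteSpace 𝔸]

/-- **BLOCK-DIAGONALITY OF THE ONE-STEP MAP (121)**: `Q(V₀, A, c)`, `c = ⟨L·y, L·y + Le_κ⟩`, takes the same value on
two fields that agree off the spine bonds and at `b₀(c)` — it does NOT depend on the eliminated variables `A(b₀(c′))`,
`c′ ≠ c`.  By name from r20's LOCALITY theorem `B7LocalityGeneral.Qcov_congr` ([4] p. 24 / p. 34: «an analytic function
of the variables A_b, b ⊂ B(c₋) ∪ B(c₊)») and `spine_in_box`.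
[cite: Balaban1985UV3, p.271 (after (62)); Balaban1985Averaging, (121) p.36, p.24 (after (43))] -/
theorem Qcov_eq_of_offSpine (hL : 1 ≤ L) (V₀ : Site d → Fin d → 𝔸ˣ) (y : Site d) (κ : Fin d)
    {A A' : Site d → Fin d → 𝔸} (hoff : ∀ z μ, z ≠ spineSite L μ (blk L z) → A z μ = A' z μ)
    (hb0 : A (spineSite L κ y) κ = A' (spineSite L κ y) κ) :
    Qcov L V₀ A (corner L y) κ = Qcov L V₀ A' (corner L y) κ :=
  B7LocalityGeneral.Qcov_congr L hL (corner L y) κ (fun _ _ _ _ => rfl) (agreeOn_of_offSpine hL y κ hoff hb0)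

/-- **BLOCK-DIAGONALITY OF THE LINEAR PART (122)** «L(Q(V₀)A)_c» (hence of the linear form (124), of which print's
`S(V_k^{(k)}, b₀(c))` is the `b₀(c)`-coefficient): no dependence on `A(b₀(c′))`, `c′ ≠ c` — the matrix «coefficient of
`A(b₀(c′))` in the `c`-th linear constraint» is block-diagonal over `c` (the shape hypothesis `hS` of
`B10Eq61EliminationTerms`, HONEST SCOPE (i) there, on the B7 carrier).
[cite: Balaban1985UV3, p.271 (after (62)); Balaban1985Averaging, (122), (124) p.36] -/
theorem linQcov_eq_of_offSpine (hL : 1 ≤ L) (V₀ : Site d → Fin d → 𝔸ˣ) (y : Site d) (κ : Fin d)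
    {A A' : Site d → Fin d → 𝔸} (hoff : ∀ z μ, z ≠ spineSite L μ (blk L z) → A z μ = A' z μ)
    (hb0 : A (spineSite L κ y) κ = A' (spineSite L κ y) κ) :
    linQcov L V₀ A (corner L y) κ = linQcov L V₀ A' (corner L y) κ := by
  unfold linQcov
  congr 1
  funext t
  exact Qcov_eq_of_offSpine hL V₀ y κ (fun z μ hz => by simp only [Pi.smul_apply, hoff z μ hz])
    (by simp only [Pi.smul_apply, hb0])

/-- The same, phrased for a PERTURBATION `B` supported on the spine bonds (the eliminated variables): `Q(V₀, A + B, c)`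
depends on `B` only through `B(b₀(c))` — replacing `B` by its `b₀(c)`-component changes nothing.
[cite: Balaban1985UV3, p.271 (after (62)); Balaban1985Averaging, (121) p.36, p.24] -/
theorem Qcov_spine_local (hL : 1 ≤ L) (V₀ : Site d → Fin d → 𝔸ˣ) (y : Site d) (κ : Fin d)
    (A B : Site d → Fin d → 𝔸) (hB : ∀ z μ, z ≠ spineSite L μ (blk L z) → B z μ = 0) :
    Qcov L V₀ (A + B) (corner L y) κ
      = Qcov L V₀ (A + fun z μ => if z = spineSite L κ y ∧ μ = κ then B z μ else 0) (corner L y) κ := by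
  refine Qcov_eq_of_offSpine hL V₀ y κ (fun z μ hz => ?_) (by simp)
  simp only [Pi.add_apply, hB z μ hz, add_zero]
  rw [if_neg, add_zero]
  rintro ⟨rfl, rfl⟩
  exact hz (by rw [blk_spineSite hL])

end Locality

/-! ## §3 The main-term block `S₀(V₀, b₀(c)) = L^{−d}·R(V₀([c₋, b₀(c)₋]))` ((125) of [4]) -/

section MainTerm

variable {𝔸 : Type*} [NormedRing 𝔸] [NormedAlgebra ℂ 𝔸]
variable {L : ℕ}

/-- **(125) is additive in `A`**: `(Q₀(A + B))_c = (Q₀A)_c + (Q₀B)_c` (the rotated functional (58) is additive in the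
field: NE7c's `B7Prop3GeneralTild.tsum_add`, by name). [cite: Balaban1985Averaging, (125) p.36] -/
theorem Q0cov_add_cfg (V₀ : Site d → Fin d → 𝔸ˣ) (A B : Site d → Fin d → 𝔸) (q : Site d) (κ : Fin d) :
    Q0cov L V₀ (A + B) q κ = Q0cov L V₀ A q κ + Q0cov L V₀ B q κ := by
  unfold Q0cov
  rw [← sum_add_distrib]
  refine sum_congr rfl fun r _ => ?_
  rw [B7Prop3GeneralTild.tsum_add, conjR_add, smul_add]

variable (L)

/-- **the spine part of a field**: `A` restricted to the spine bonds `b₀(c)` (the eliminated variables «B(b₀)» of [5]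
p. 428), zero elsewhere. [cite: Balaban1985BackgroundPropagators, p.428 (after (3.156))] -/
def spinePart (A : Site d → Fin d → 𝔸) : Site d → Fin d → 𝔸 :=
  fun z μ => if z = spineSite L μ (blk L z) then A z μ else 0

/-- **the off-spine part of a field**: `A` restricted to the bonds that are NOT spine bonds (the retained variables
on `Λ̃` plus the axial bonds), zero on the spine bonds. [cite: Balaban1985BackgroundPropagators, p.428 (after (3.156))] -/
def offSpinePart (A : Site d → Fin d → 𝔸) : Site d → Fin d → 𝔸 :=
  fun z μ => if z = spineSite L μ (blk L z) then 0 else A z μ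

/-- **THE MAIN-TERM BLOCK `S₀(V₀, b₀(c))`** for `c = ⟨L·y, L·y + Le_κ⟩`: `X ↦ L^{−d}·R(V₀([L·y, L·y + (L−1)e_κ]))X` —
the `L` segments `[x, x′]` of (125) through `b₀(c)` start at the `L` axis points of `B(c₋)` and all reach `b₀(c)₋`
along the same straight path from `c₋`, each weighted `L^{−(d+1)}`.  (The `b₀(c)`-coefficient of the MAIN TERM (125);
print's `S(V, b₀(c))` is read off the full (124).) [cite: Balaban1985UV3, p.271 (after (62)); Balaban1985Averaging, (125) p.36] -/
def mainCoeff (V₀ : Site d → Fin d → 𝔸ˣ) (y : Site d) (κ : Fin d) (X : 𝔸) : 𝔸 :=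
  (((L : ℝ) ^ d)⁻¹) • conjR (hol V₀ (corner L y) (seg κ (((L - 1 : ℕ) : ℤ)))) X

variable {L}

omit [NormedAlgebra ℂ 𝔸] in
/-- `A = A_spine + A_offspine`. [cite: Balaban1985BackgroundPropagators, p.428 (after (3.156))] -/
theorem spinePart_add_offSpinePart (A : Site d → Fin d → 𝔸) : spinePart L A + offSpinePart L A = A := by
  funext z μ
  simp only [Pi.add_apply, spinePart, offSpinePart]
  split_ifs <;> simp

omit [NormedAlgebra ℂ 𝔸] in
/-- the off-spine part vanishes on the spine bonds. [cite: Balaban1985BackgroundPropagators, p.428 (after (3.156))] -/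
theorem offSpinePart_spine (A : Site d → Fin d → 𝔸) (z : Site d) (μ : Fin d) (hz : z = spineSite L μ (blk L z)) :
    offSpinePart L A z μ = 0 := by
  simp only [offSpinePart, if_pos hz]

omit [NormedAlgebra ℂ 𝔸] in
/-- the spine part vanishes off the spine bonds. [cite: Balaban1985BackgroundPropagators, p.428 (after (3.156))] -/
theorem spinePart_offSpine (A : Site d → Fin d → 𝔸) (z : Site d) (μ : Fin d) (hz : z ≠ spineSite L μ (blk L z)) :
    spinePart L A z μ = 0 := by
  simp only [spinePart, if_neg hz]

/-- unfolding of the main-term block. [cite: Balaban1985Averaging, (125) p.36] -/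
theorem mainCoeff_apply (V₀ : Site d → Fin d → 𝔸ˣ) (y : Site d) (κ : Fin d) (X : 𝔸) :
    mainCoeff L V₀ y κ X = (((L : ℝ) ^ d)⁻¹) • conjR (hol V₀ (corner L y) (seg κ (((L - 1 : ℕ) : ℤ)))) X := rfl

/-- **The spine part of ANY field is NE9's section** of the coarse field `w(y, κ) := S₀(V₀, b₀(c))A(b₀(c))`:
`A_spine = S(w)` with `(S w)(b₀(c)) = L^d·R(V₀([c₋, b₀₋]))⁻¹ w(y, κ)`. [cite: Balaban1985Averaging, (125) p.36] -/
theorem spinePart_eq_secCfg (hL : 1 ≤ L) (V₀ : Site d → Fin d → 𝔸ˣ) (A : Site d → Fin d → 𝔸) :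
    spinePart L A = secCfg L V₀ (fun y κ => mainCoeff L V₀ y κ (A (spineSite L κ y) κ)) := by
  have hL0 : ((L : ℝ) ^ d) ≠ 0 := pow_ne_zero _ (by exact_mod_cast (show L ≠ 0 by omega))
  funext z μ
  unfold spinePart secCfg
  split_ifs with hz
  · dsimp only
    rw [mainCoeff_apply, conjR_smul_real, smul_smul, mul_inv_cancel₀ hL0, one_smul, conjR_conjR, inv_mul_cancel,
      one_conjR, ← hz]
  · rfl

/-- **`(Q₀ A_spine)(c) = S₀(V₀, b₀(c)) A(b₀(c))`** — on fields supported on the spine bonds the main term (125) at `c`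
depends on the value at `b₀(c)` ALONE, through the block `mainCoeff`: block-diagonality AND the block, exact for every
background (by name from NE9's `Q0cov_secCfg`). [cite: Balaban1985UV3, p.271 (after (62)); Balaban1985Averaging, (125) p.36] -/
theorem Q0cov_spinePart (hL : 1 ≤ L) (V₀ : Site d → Fin d → 𝔸ˣ) (A : Site d → Fin d → 𝔸) (y : Site d) (κ : Fin d) :
    Q0cov L V₀ (spinePart L A) (corner L y) κ = mainCoeff L V₀ y κ (A (spineSite L κ y) κ) := by
  rw [spinePart_eq_secCfg hL V₀ A, Q0cov_secCfg hL]

/-- **«THE COEFFICIENT AT THE VARIABLE A(b₀(c)) IN (QA)(c)», MAIN TERM**: for every field `A` and every background,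
`(Q₀A)(c) = S₀(V₀, b₀(c))·A(b₀(c)) + (Q₀A_offspine)(c)`, the second summand involving no spine variable at all.
[cite: Balaban1985UV3, p.271 (after (62)); Balaban1985Averaging, (125) p.36] -/
theorem Q0cov_eq_mainCoeff_add (hL : 1 ≤ L) (V₀ : Site d → Fin d → 𝔸ˣ) (A : Site d → Fin d → 𝔸) (y : Site d)
    (κ : Fin d) :
    Q0cov L V₀ A (corner L y) κ
      = mainCoeff L V₀ y κ (A (spineSite L κ y) κ) + Q0cov L V₀ (offSpinePart L A) (corner L y) κ := by
  conv_lhs => rw [← spinePart_add_offSpinePart (L := L) A]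
  rw [Q0cov_add_cfg, Q0cov_spinePart hL]

/-- At the flat background the block is the scalar `L^{−d}`: `S₀(1, b₀(c)) = L^{−d}·id`. [cite: Balaban1985Averaging, (125) p.36] -/
theorem mainCoeff_one (y : Site d) (κ : Fin d) (X : 𝔸) :
    mainCoeff L (1 : Site d → Fin d → 𝔸ˣ) y κ X = (((L : ℝ) ^ d)⁻¹) • X := by
  rw [mainCoeff_apply, B8Ineq130.hol_one, one_conjR]

/-- The block is additive … [cite: Balaban1985Averaging, (56)–(57) p.27, (125) p.36] -/
theorem mainCoeff_add (V₀ : Site d → Fin d → 𝔸ˣ) (y : Site d) (κ : Fin d) (X Y : 𝔸) :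
    mainCoeff L V₀ y κ (X + Y) = mainCoeff L V₀ y κ X + mainCoeff L V₀ y κ Y := by
  simp only [mainCoeff_apply, conjR_add, smul_add]

/-- … and real-homogeneous: a real-linear operator on the algebra (on 𝔤 ⊂ 𝔸 in print). [cite: Balaban1985Averaging, (56)–(57) p.27, (125) p.36] -/
theorem mainCoeff_smul (V₀ : Site d → Fin d → 𝔸ˣ) (y : Site d) (κ : Fin d) (t : ℝ) (X : 𝔸) :
    mainCoeff L V₀ y κ (t • X) = t • mainCoeff L V₀ y κ X := by
  rw [mainCoeff_apply, mainCoeff_apply, conjR_smul_real, smul_comm]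

/-- **`‖S₀(V₀, b₀(c))X‖ = L^{−d}‖X‖`** for a background in `U1` (unitaries): the main-term block is `L^{−d}` times an
ISOMETRY of the algebra (`B8Ineq132.norm_conjR`: the rotations `R(u)` preserve norms) — the shape «scalar × adjoint
action» of the audit cell's criterion. [cite: Balaban1985UV3, p.271 (after (62)); Balaban1985Averaging, (56)–(57) p.27, (125) p.36] -/
theorem norm_mainCoeff [NormOneClass 𝔸] (hL : 1 ≤ L) {V₀ : Site d → Fin d → 𝔸ˣ} (hV₀ : ∀ x κ, V₀ x κ ∈ U1 𝔸)
    (y : Site d) (κ : Fin d) (X : 𝔸) : ‖mainCoeff L V₀ y κ X‖ = (((L : ℝ) ^ d)⁻¹) * ‖X‖ := by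
  rw [mainCoeff_apply, norm_smul, norm_conjR (hol_mem hV₀ _ _), Real.norm_of_nonneg (by positivity)]

/-- [5] p. 428 «(QB)(c) = 0, considered as an equation on the variable B(b₀)»: for the main term the block is
injective (indeed invertible, inverse `L^d·R(V₀(…))⁻¹` — NE9's right inverse), so the equation determines `B(b₀(c))`.
[cite: Balaban1985BackgroundPropagators, p.428 (after (3.156)); Balaban1985Averaging, (125) p.36] -/
theorem mainCoeff_injective (hL : 1 ≤ L) (V₀ : Site d → Fin d → 𝔸ˣ) (y : Site d) (κ : Fin d) :
    Function.Injective (mainCoeff L V₀ y κ) := by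
  have hL0 : ((L : ℝ) ^ d) ≠ 0 := pow_ne_zero _ (by exact_mod_cast (show L ≠ 0 by omega))
  intro X Y h
  have h' := congrArg (fun Z => conjR (hol V₀ (corner L y) (seg κ (((L - 1 : ℕ) : ℤ))))⁻¹ (((L : ℝ) ^ d) • Z)) h
  simpa only [mainCoeff_apply, smul_smul, mul_inv_cancel₀ hL0, one_smul, conjR_conjR, inv_mul_cancel,
    one_conjR] using h'

/-- The main-term equation solved: `S₀(V₀, b₀(c))(L^d·R(V₀(…))⁻¹ w) = w`. [cite: Balaban1985BackgroundPropagators, p.428 (after (3.156)); Balaban1985Averaging, (125) p.36] -/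
theorem mainCoeff_solve (hL : 1 ≤ L) (V₀ : Site d → Fin d → 𝔸ˣ) (y : Site d) (κ : Fin d) (w : 𝔸) :
    mainCoeff L V₀ y κ (((L : ℝ) ^ d) • conjR (hol V₀ (corner L y) (seg κ (((L - 1 : ℕ) : ℤ))))⁻¹ w) = w := by
  have hL0 : ((L : ℝ) ^ d) ≠ 0 := pow_ne_zero _ (by exact_mod_cast (show L ≠ 0 by omega))
  rw [mainCoeff_apply, conjR_smul_real, smul_smul, inv_mul_cancel₀ hL0, one_smul, conjR_conjR, mul_inv_cancel,
    one_conjR]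

end MainTerm

/-! ## §4 The determinant of a scaled isometry ([folklore] linear algebra) -/

section Isometry

variable {E : Type*} [NormedAddCommGroup E] [InnerProductSpace ℝ E]
variable {ι : Type*} [Fintype ι] [DecidableEq ι]

/-- In an orthonormal basis the matrix `O` of an inner-product-preserving linear map satisfies `OᵀO = 1` (Parseval).
This is how «a scalar times the adjoint action of a group element in a tr-orthonormal basis of 𝔤» (the audit cell's
phrase) becomes `t·O`, `OᵀO = 1`, once 𝔤 carries an Ad-invariant inner product (the trace form (17) of [4]).  Linear
algebra behind print's «−log det S(V_k^{(k)}, b₀(c))», tagged by its locus of use; our proof. [cite: Balaban1985UV3, p.271 (after (62))] -/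
theorem toMatrix_transpose_mul_self_eq_one_of_inner (b : OrthonormalBasis ι ℝ E) (T : E →ₗ[ℝ] E)
    (hT : ∀ x y : E, inner ℝ (T x) (T y) = inner ℝ x y) :
    (LinearMap.toMatrix b.toBasis b.toBasis T)ᵀ * LinearMap.toMatrix b.toBasis b.toBasis T = 1 := by
  ext i j
  rw [Matrix.mul_apply, Matrix.one_apply]
  have hentry : ∀ k l, LinearMap.toMatrix b.toBasis b.toBasis T k l = inner ℝ (b k) (T (b l)) := fun k l => by
    rw [LinearMap.toMatrix_apply, OrthonormalBasis.coe_toBasis_repr_apply, OrthonormalBasis.repr_apply_apply,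
      OrthonormalBasis.coe_toBasis]
  simp_rw [Matrix.transpose_apply, hentry]
  have hsum : ∑ k, inner ℝ (b k) (T (b i)) * inner ℝ (b k) (T (b j)) = inner ℝ (T (b i)) (T (b j)) := by
    rw [← OrthonormalBasis.sum_inner_mul_inner b (T (b i)) (T (b j))]
    refine sum_congr rfl fun k _ => ?_
    rw [real_inner_comm (b k) (T (b i))]
  rw [hsum, hT]
  exact orthonormal_iff_ite.1 b.orthonormal i j

/-- **`|det(t·T)| = |t|^{dim}`** for an inner-product-preserving `T` — the audit cell's criterion
`Beta.ConstraintElimination.abs_det_smul_of_transpose_mul_self_eq_one` in coordinates.  With `t = L^{−d}` and `T` = the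
adjoint rotation of the main-term block (§3), `|det S₀(V₀, b₀(c))| = L^{−d·dim 𝔤}` whatever the background: the local
term `−log|det S₀|` of p. 271 is, FOR THE MAIN TERM, the constant `d·dim 𝔤·log L` (linear algebra, tagged by its
locus of use; our proof). [cite: Balaban1985UV3, p.271 (after (62))] -/
theorem abs_det_toMatrix_smul_of_inner (b : OrthonormalBasis ι ℝ E) (T : E →ₗ[ℝ] E)
    (hT : ∀ x y : E, inner ℝ (T x) (T y) = inner ℝ x y) (t : ℝ) :
    |(LinearMap.toMatrix b.toBasis b.toBasis (t • T)).det| = |t| ^ Fintype.card ι := by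
  rw [LinearEquiv.map_smul]
  exact Beta.ConstraintElimination.abs_det_smul_of_transpose_mul_self_eq_one t _
    (toMatrix_transpose_mul_self_eq_one_of_inner b T hT)

/-- A norm-preserving real-linear map preserves the inner product (polarisation) — so §3's `norm_mainCoeff`-type
isometry is all that §4 needs, for any Ad-invariant Euclidean structure on 𝔤 (linear algebra, tagged by its locus of
use; our proof). [cite: Balaban1985UV3, p.271 (after (62))] -/
theorem inner_map_map_of_norm_map (T : E →ₗ[ℝ] E) (hT : ∀ x : E, ‖T x‖ = ‖x‖) (x y : E) :
    inner ℝ (T x) (T y) = inner ℝ x y := by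
  rw [real_inner_eq_norm_add_mul_self_sub_norm_mul_self_sub_norm_mul_self_div_two,
    real_inner_eq_norm_add_mul_self_sub_norm_mul_self_sub_norm_mul_self_div_two, ← map_add, hT, hT, hT]

end Isometry

/-! ## §5 Consequence for (61): main-term-shaped blocks give a background-free Jacobian -/

section Bracket

variable {o dd : Type*} [Fintype o] [DecidableEq o] [Fintype dd] [DecidableEq dd]

omit [DecidableEq o] in
/-- If every block has the main-term shape `t·O_c`, `O_cᵀO_c = 1`, then `Σ_c log|det S_c| = |o|·dim·log|t|` — the same
number for every background. [cite: Balaban1985UV3, p.271 (after (62))] -/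
theorem sum_log_abs_det_eq_of_shape (S : o → Matrix dd dd ℝ) (t : ℝ)
    (hS : ∀ c, ∃ O : Matrix dd dd ℝ, Oᵀ * O = 1 ∧ S c = t • O) :
    ∑ c, Real.log |(S c).det| = Fintype.card o * (Fintype.card dd * Real.log |t|) := by
  have h : ∀ c, Real.log |(S c).det| = Fintype.card dd * Real.log |t| := fun c => by
    obtain ⟨O, hO, hc⟩ := hS c
    rw [hc, Beta.ConstraintElimination.abs_det_smul_of_transpose_mul_self_eq_one t O hO, Real.log_pow]
  simp_rw [h]
  rw [sum_const, card_univ, nsmul_eq_mul]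

/-- Two families of main-term-shaped blocks (backgrounds `U_{k+1}` and `1`, same `t = L^{−d}`) have block-diagonal
assemblies of EQUAL `|det|` — the hypothesis `hJ` of `B10Eq61EliminationTerms.logZ_sub_logZ_eq_of_abs_det_eq`.
[cite: Balaban1985UV3, (61) p.271] -/
theorem abs_det_eq_of_shape {m : ℕ} (Q₁ Q₀ : Matrix (Fin m) (Fin m) ℝ) (em : Fin m ≃ dd × o)
    (S₁ S₀ : o → Matrix dd dd ℝ) (t : ℝ)
    (hS₁ : Matrix.reindex em em Q₁ = Matrix.blockDiagonal S₁) (hS₀ : Matrix.reindex em em Q₀ = Matrix.blockDiagonal S₀)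
    (h₁ : ∀ c, ∃ O : Matrix dd dd ℝ, Oᵀ * O = 1 ∧ S₁ c = t • O)
    (h₀ : ∀ c, ∃ O : Matrix dd dd ℝ, Oᵀ * O = 1 ∧ S₀ c = t • O) : |Q₁.det| = |Q₀.det| := by
  rw [← Matrix.det_reindex_self em Q₁, ← Matrix.det_reindex_self em Q₀, hS₁, hS₀,
    Beta.ConstraintElimination.abs_det_blockDiagonal, Beta.ConstraintElimination.abs_det_blockDiagonal]
  have key : ∀ (S : o → Matrix dd dd ℝ), (∀ c, ∃ O : Matrix dd dd ℝ, Oᵀ * O = 1 ∧ S c = t • O) →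
      ∏ c, |(S c).det| = ∏ _c : o, |t| ^ Fintype.card dd := fun S hS =>
    prod_congr rfl fun c _ => by
      obtain ⟨O, hO, hc⟩ := hS c
      rw [hc, Beta.ConstraintElimination.abs_det_smul_of_transpose_mul_self_eq_one t O hO]
  rw [key S₁ h₁, key S₀ h₀]

open MeasureTheory B10Eq55GaussianStep B10Eq61EliminationTerms in
/-- **(61) FOR MAIN-TERM-SHAPED ELIMINATION BLOCKS**: if the `κ`-blocks `Q_κ(U_{k+1})`, `Q_κ(1)` of the two constrained
normalisations of (61) are block-diagonal over the coarse bonds with blocks of the main-term shape `L^{−d}·O_c`,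
`O_cᵀO_c = 1` (§3–§4), then the local terms `−Σ_c log|det S_c|` are the same constant for both backgrounds and
`log Z^{(k)}(·, U_{k+1}) − log Z^{(k)}(·, 1)` is EXACTLY the Gaussian bracket (by name from
`B10Eq61EliminationTerms.logZ_sub_logZ_eq_of_abs_det_eq`).  For the full (124) the blocks are `S₀(1 + O(L²α₀))` and
the local terms survive as print's «simple, local, gauge invariant functions of V_k^{(k)}» — NOT claimed to cancel.
[cite: Balaban1985UV3, (61) p.271] -/
theorem logZ_sub_logZ_eq_of_mainTerm_shape {n m r : ℕ} (Z₁ Z₀ : Beta.ConstrainedGaussian n m)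
    (e₁ e₀ : Fin n ≃ Fin r ⊕ Fin m) (em : Fin m ≃ dd × o) (S₁ S₀ : o → Matrix dd dd ℝ) (t : ℝ)
    (hS₁ : Matrix.reindex em em (Z₁.constraintEliminated e₁) = Matrix.blockDiagonal S₁)
    (hS₀ : Matrix.reindex em em (Z₀.constraintEliminated e₀) = Matrix.blockDiagonal S₀)
    (h₁ : ∀ c, ∃ O : Matrix dd dd ℝ, Oᵀ * O = 1 ∧ S₁ c = t • O)
    (h₀ : ∀ c, ∃ O : Matrix dd dd ℝ, Oᵀ * O = 1 ∧ S₀ c = t • O)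
    (hκ₁ : (Z₁.constraintEliminated e₁).det ≠ 0) (hκ₀ : (Z₀.constraintEliminated e₀).det ≠ 0)
    (hC₁ : (Z₁.reduced (Z₁.elimMatrix e₁)).PosDef) (hC₀ : (Z₀.reduced (Z₀.elimMatrix e₀)).PosDef) :
    Z₁.logZ - Z₀.logZ
      = Real.log (Zk (volume : Measure (Fin r → ℝ)) (Matrix.toLinearMap₂' ℝ (Z₁.reduced (Z₁.elimMatrix e₁))))
        - Real.log (Zk (volume : Measure (Fin r → ℝ)) (Matrix.toLinearMap₂' ℝ (Z₀.reduced (Z₀.elimMatrix e₀)))) :=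
  logZ_sub_logZ_eq_of_abs_det_eq Z₁ Z₀ e₁ e₀ hκ₁ hκ₀ hC₁ hC₀
    (abs_det_eq_of_shape _ _ em S₁ S₀ t hS₁ hS₀ h₁ h₀)

end Bracket

/-! ## §6 Gauge covariance of the main-term block («gauge invariant functions of V_k^{(k)}», p. 271) -/

section Gauge

variable {𝔸 : Type*} [NormedRing 𝔸] [NormedAlgebra ℂ 𝔸]
variable {L : ℕ}

/-- **GAUGE COVARIANCE OF THE MAIN-TERM BLOCK**: under the gauge transformation (8) of [4], `V₀ ↦ V₀^u`,
`u(x)V₀(x,x′)u(x′)⁻¹`, the block transforms by conjugation with the rotations at the two ends of the path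
`[c₋, b₀(c)₋]`: `S₀(V₀^u, b₀(c)) = R(u(c₋)) ∘ S₀(V₀, b₀(c)) ∘ R(u(b₀(c)₋))⁻¹` — whence every conjugation-invariant
function of the block (its determinant on 𝔤, its norm) is GAUGE INVARIANT, print's «simple, local, gauge invariant
functions of V_k^{(k)}» for the main term. [cite: Balaban1985UV3, p.271 (after (62)); Balaban1985Averaging, (8) p.18, (125) p.36] -/
theorem mainCoeff_gaugeAct (hL : 1 ≤ L) (u : Site d → 𝔸ˣ) (V₀ : Site d → Fin d → 𝔸ˣ) (y : Site d) (κ : Fin d)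
    (X : 𝔸) :
    mainCoeff L (gaugeAct u V₀) y κ X
      = conjR (u (corner L y)) (mainCoeff L V₀ y κ (conjR (u (spineSite L κ y))⁻¹ X)) := by
  rw [mainCoeff_apply, mainCoeff_apply, hol_gaugeAct, disp_seg, ← spineSite_eq hL, conjR_smul_real,
    B7Prop3GeneralRotated.conjR_mul_left, B7Prop3GeneralRotated.conjR_mul_left]

/-- The same with the gauge rotation moved to the other side: `R(u(c₋))⁻¹ S₀(V₀^u, b₀(c)) R(u(b₀(c)₋)) = S₀(V₀, b₀(c))`
— the block is determined by the background up to the conjugations at the two ends. [cite: Balaban1985UV3, p.271 (after (62)); Balaban1985Averaging, (8) p.18, (125) p.36] -/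
theorem conjR_inv_mainCoeff_gaugeAct (hL : 1 ≤ L) (u : Site d → 𝔸ˣ) (V₀ : Site d → Fin d → 𝔸ˣ) (y : Site d)
    (κ : Fin d) (X : 𝔸) :
    conjR (u (corner L y))⁻¹ (mainCoeff L (gaugeAct u V₀) y κ (conjR (u (spineSite L κ y)) X))
      = mainCoeff L V₀ y κ X := by
  rw [mainCoeff_gaugeAct hL, conjR_conjR, inv_mul_cancel, one_conjR, conjR_conjR, inv_mul_cancel, one_conjR]

/-- **Gauge invariance of the block's size**: `‖S₀(V₀^u, b₀(c))X‖ = ‖S₀(V₀, b₀(c))(R(u(b₀(c)₋))⁻¹X)‖` for gauge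
transformations with values in `U1` — with `norm_mainCoeff`, both sides are `L^{−d}‖X‖`. [cite: Balaban1985UV3, p.271 (after (62)); Balaban1985Averaging, (8) p.18] -/
theorem norm_mainCoeff_gaugeAct [NormOneClass 𝔸] (hL : 1 ≤ L) {u : Site d → 𝔸ˣ} (hu : ∀ x, u x ∈ U1 𝔸)
    (V₀ : Site d → Fin d → 𝔸ˣ) (y : Site d) (κ : Fin d) (X : 𝔸) :
    ‖mainCoeff L (gaugeAct u V₀) y κ X‖ = ‖mainCoeff L V₀ y κ (conjR (u (spineSite L κ y))⁻¹ X)‖ := by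
  rw [mainCoeff_gaugeAct hL, norm_conjR (hu _)]

end Gauge

/-! ## §7 The `b₀(c)`-coefficient of the FULL linear part (122) — gauge covariance («gauge invariant functions of V_k^{(k)}») -/

section FullCoefficient

variable {𝔸 : Type*} [NormedRing 𝔸] [NormedAlgebra ℂ 𝔸] [CompleteSpace 𝔸]
variable (L : ℕ)

/-- **the single-bond field** carrying `X` on the bond `(z₀, μ₀)` and `0` elsewhere (a Lie-algebra variable on one bond).
[cite: Balaban1985BackgroundPropagators, p.428 (after (3.156))] -/
def bondField (z₀ : Site d) (μ₀ : Fin d) (X : 𝔸) : Site d → Fin d → 𝔸 :=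
  fun z μ => if z = z₀ ∧ μ = μ₀ then X else 0

/-- **THE `b₀(c)`-COEFFICIENT OF THE FULL LINEAR PART (122)**: `X ↦ L(Q(V₀)·)_c` applied to the single-bond field `X` on
`b₀(c)` — the directional derivative of the one-step map (121) at `0` in the direction of the eliminated variable.  In the
reading C-adv4-22 of (122) («L(Q(V₀)A)_c» = `L·(Q(V₀)A)_c` with (124) the `L^{−(d+1)}`-normalised form) print's
`S(V_k^{(k)}, b₀(c))` read off (124) is `L⁻¹ ×` this operator; its main term is `L·S₀(V₀, b₀(c))` (§3).
[cite: Balaban1985UV3, p.271 (after (62)); Balaban1985Averaging, (122), (124) p.36] -/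
def fullCoeff (V₀ : Site d → Fin d → 𝔸ˣ) (y : Site d) (κ : Fin d) (X : 𝔸) : 𝔸 :=
  linQcov L V₀ (bondField (spineSite L κ y) κ X) (corner L y) κ

variable {L}

omit [NormedAlgebra ℂ 𝔸] [CompleteSpace 𝔸] in
/-- rotating a single-bond field bondwise rotates its value. [cite: Balaban1985Averaging, (56)–(57) p.27] -/
theorem conjR_bondField (u : Site d → 𝔸ˣ) (z₀ : Site d) (μ₀ : Fin d) (X : 𝔸) :
    (fun z μ => conjR (u z) (bondField z₀ μ₀ X z μ)) = bondField z₀ μ₀ (conjR (u z₀) X) := by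
  funext z μ
  unfold bondField
  split_ifs with h
  · rw [h.1]
  · rw [conjR_apply, mul_zero, zero_mul]

/-- **GAUGE COVARIANCE OF THE FULL `b₀(c)`-COEFFICIENT**: `S(V₀^u, b₀(c))·R(u(b₀(c)₋)) = R(u(c₋))·S(V₀, b₀(c))` — under
the gauge transformation (8) the coefficient of the FULL linear part (122)/(124) at `b₀(c)` is conjugated by the rotations
at `c₋` and at `b₀(c)₋`; by name from `B9Eq332FieldAvgCovariance.linQcov_rot` ((3.32) of [5]: `(Q(V₀^u)R(u)A)_c =
R(u(c₋))(Q(V₀)A)_c`).  Hence every conjugation-invariant function of the block — `det S(V_k^{(k)}, b₀(c))` on 𝔤 for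
Ad-isometric rotations — is GAUGE INVARIANT: print's «simple, local, gauge invariant functions of V_k^{(k)}», for the
ACTUAL coefficient, not only its main term. [cite: Balaban1985UV3, p.271 (after (62)); Balaban1985BackgroundPropagators, (3.32) p.395; Balaban1985Averaging, (8) p.18, (122) p.36] -/
theorem fullCoeff_gaugeAct (u : Site d → 𝔸ˣ) (V₀ : Site d → Fin d → 𝔸ˣ) (y : Site d) (κ : Fin d) (X : 𝔸) :
    fullCoeff L (gaugeAct u V₀) y κ (conjR (u (spineSite L κ y)) X) = conjR (u (corner L y)) (fullCoeff L V₀ y κ X) := by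
  unfold fullCoeff
  rw [← conjR_bondField, B9Eq332FieldAvgCovariance.linQcov_rot]

/-- The same as a conjugation formula: `S(V₀^u, b₀(c)) = R(u(c₋)) ∘ S(V₀, b₀(c)) ∘ R(u(b₀(c)₋))⁻¹`.
[cite: Balaban1985UV3, p.271 (after (62)); Balaban1985BackgroundPropagators, (3.32) p.395; Balaban1985Averaging, (8) p.18] -/
theorem fullCoeff_gaugeAct' (u : Site d → 𝔸ˣ) (V₀ : Site d → Fin d → 𝔸ˣ) (y : Site d) (κ : Fin d) (X : 𝔸) :
    fullCoeff L (gaugeAct u V₀) y κ X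
      = conjR (u (corner L y)) (fullCoeff L V₀ y κ (conjR (u (spineSite L κ y))⁻¹ X)) := by
  rw [← fullCoeff_gaugeAct, conjR_conjR, mul_inv_cancel, one_conjR]

/-- **BLOCK-DIAGONALITY, restated for the full coefficient**: adding to the single-bond field on `b₀(c)` ANY field supported
on the OTHER spine bonds does not change `L(Q(V₀)·)_c` — the `c`-th linear constraint sees the eliminated variables only
through `b₀(c)` (§2 `linQcov_eq_of_offSpine`). [cite: Balaban1985UV3, p.271 (after (62)); Balaban1985Averaging, (122) p.36, p.24 (after (43))] -/
theorem linQcov_bondField_add_offBlock (hL : 1 ≤ L) (V₀ : Site d → Fin d → 𝔸ˣ) (y : Site d) (κ : Fin d) (X : 𝔸)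
    (B : Site d → Fin d → 𝔸) (hB : ∀ z μ, z ≠ spineSite L μ (blk L z) → B z μ = 0) (hB0 : B (spineSite L κ y) κ = 0) :
    linQcov L V₀ (bondField (spineSite L κ y) κ X + B) (corner L y) κ = fullCoeff L V₀ y κ X := by
  unfold fullCoeff
  refine linQcov_eq_of_offSpine hL V₀ y κ (fun z μ hz => ?_) (by simp [hB0])
  simp only [Pi.add_apply, hB z μ hz, add_zero]

omit [CompleteSpace 𝔸] in
/-- (125) vanishes on the zero field. [cite: Balaban1985Averaging, (125) p.36] -/
theorem Q0cov_zero_cfg (V₀ : Site d → Fin d → 𝔸ˣ) (q : Site d) (κ : Fin d) :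
    Q0cov L V₀ (0 : Site d → Fin d → 𝔸) q κ = 0 := by
  have h := Q0cov_add_cfg (L := L) V₀ (0 : Site d → Fin d → 𝔸) 0 q κ
  rw [add_zero] at h
  calc Q0cov L V₀ (0 : Site d → Fin d → 𝔸) q κ
      = (Q0cov L V₀ (0 : Site d → Fin d → 𝔸) q κ + Q0cov L V₀ (0 : Site d → Fin d → 𝔸) q κ)
          - Q0cov L V₀ (0 : Site d → Fin d → 𝔸) q κ := by rw [add_sub_cancel_right]
    _ = 0 := by rw [← h, sub_self]

omit [CompleteSpace 𝔸] in
/-- The MAIN TERM (125) on the single-bond field at `b₀(c)`: `(Q₀ δ_{b₀(c)}X)(c) = S₀(V₀, b₀(c))X` — the main-term block of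
§3 is the main term of the full coefficient. [cite: Balaban1985UV3, p.271 (after (62)); Balaban1985Averaging, (125) p.36] -/
theorem Q0cov_bondField (hL : 1 ≤ L) (V₀ : Site d → Fin d → 𝔸ˣ) (y : Site d) (κ : Fin d) (X : 𝔸) :
    Q0cov L V₀ (bondField (spineSite L κ y) κ X) (corner L y) κ = mainCoeff L V₀ y κ X := by
  rw [Q0cov_eq_mainCoeff_add hL]
  have h0 : offSpinePart L (bondField (spineSite L κ y) κ X) = 0 := by
    funext z μ
    unfold offSpinePart bondField
    split_ifs with h1 h2
    · rfl
    · exfalso; obtain ⟨rfl, rfl⟩ := h2; exact h1 (by rw [blk_spineSite hL])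
    · rfl
  have hb : bondField (spineSite L κ y) κ X (spineSite L κ y) κ = X := by simp [bondField]
  rw [h0, Q0cov_zero_cfg, add_zero, hb]

/-- **THE FULL COEFFICIENT AT THE FLAT BACKGROUND**: `S(1, b₀(c)) = L·S₀(1, b₀(c)) = L^{1−d}·id` (the linear part of (121)
at `V₀ = 1` is b07's `linQ = L·Q₀`, `B7Prop3GeneralLinear.linQcov_one_left` + `B7Prop3Flat.linQ_eq_smul_Q0form` by name).
[cite: Balaban1985Averaging, (122), (125) p.36] -/
theorem fullCoeff_one [NormOneClass 𝔸] (hL : 1 ≤ L) (y : Site d) (κ : Fin d) (X : 𝔸) :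
    fullCoeff L (1 : Site d → Fin d → 𝔸ˣ) y κ X = (L : ℝ) • ((((L : ℝ) ^ d)⁻¹) • X) := by
  unfold fullCoeff
  have hb : ∀ z μ, ‖bondField (spineSite L κ y) κ X z μ‖ ≤ ‖X‖ := fun z μ => by
    unfold bondField
    split_ifs
    · exact le_rfl
    · rw [norm_zero]; exact norm_nonneg X
  rw [linQcov_one_left L hL _ (norm_nonneg X) hb, B7Prop3Flat.linQ_eq_smul_Q0form L hL, ← Q0cov_one_left,
    Q0cov_bondField hL, mainCoeff_one]

end FullCoefficient

/-! ## §8 Invertibility of the full `b₀(c)`-coefficient at a regular background ([5] p. 428 «considered as an equation on the variable B(b₀)») -/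

section Invertibility

variable {𝔸 : Type*} [NormedRing 𝔸] [NormedAlgebra ℂ 𝔸] [NormOneClass 𝔸] [CompleteSpace 𝔸]
variable {L : ℕ}

omit [NormedAlgebra ℂ 𝔸] [NormOneClass 𝔸] [CompleteSpace 𝔸] in
/-- the single-bond field is additive in its value. [cite: Balaban1985BackgroundPropagators, p.428 (after (3.156))] -/
theorem bondField_add (z₀ : Site d) (μ₀ : Fin d) (X Y : 𝔸) :
    bondField z₀ μ₀ (X + Y) = bondField z₀ μ₀ X + bondField z₀ μ₀ Y := by
  funext z μ
  simp only [bondField, Pi.add_apply]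
  split_ifs <;> simp

omit [NormOneClass 𝔸] [CompleteSpace 𝔸] in
/-- … and real-homogeneous. [cite: Balaban1985BackgroundPropagators, p.428 (after (3.156))] -/
theorem bondField_smul (z₀ : Site d) (μ₀ : Fin d) (c : ℂ) (X : 𝔸) :
    bondField z₀ μ₀ (c • X) = c • bondField z₀ μ₀ X := by
  funext z μ
  simp only [bondField, Pi.smul_apply]
  split_ifs <;> simp

omit [NormedAlgebra ℂ 𝔸] [NormOneClass 𝔸] [CompleteSpace 𝔸] in
/-- the single-bond field is bounded by its value. [cite: Balaban1985BackgroundPropagators, p.428 (after (3.156))] -/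
theorem norm_bondField_le (z₀ : Site d) (μ₀ : Fin d) (X : 𝔸) (z : Site d) (μ : Fin d) :
    ‖bondField z₀ μ₀ X z μ‖ ≤ ‖X‖ := by
  unfold bondField
  split_ifs
  · exact le_rfl
  · rw [norm_zero]; exact norm_nonneg X

/-- **The full `b₀(c)`-coefficient is ADDITIVE** at a background whose block loops satisfy `‖W_x(V₀) − 1‖ < 1` — the linear
part (122) is then additive in the field (NE7c's `B7Prop3GeneralTild.linQcov_add`, «its Taylor expansion begins with a
first-order polynomial»), so `fullCoeff` IS the coefficient of a linear map. [cite: Balaban1985Averaging, (122) p.36; Balaban1985UV3, p.271 (after (62))] -/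
theorem fullCoeff_add (V₀ : Site d → Fin d → 𝔸ˣ) (y : Site d) (κ : Fin d)
    (hW : ∀ r : Fin d → Fin L, ‖((Wcx L V₀ (corner L y) κ (boxVec L r) : 𝔸ˣ) : 𝔸) - 1‖ < 1) (X Y : 𝔸) :
    fullCoeff L V₀ y κ (X + Y) = fullCoeff L V₀ y κ X + fullCoeff L V₀ y κ Y := by
  unfold fullCoeff
  rw [bondField_add, B7Prop3GeneralTild.linQcov_add L V₀ _ _ _ κ hW]

/-- … and `ℂ`-homogeneous (`B7Prop3GeneralTild.linQcov_smul`). [cite: Balaban1985Averaging, (122) p.36; Balaban1985UV3, p.271 (after (62))] -/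
theorem fullCoeff_smul (V₀ : Site d → Fin d → 𝔸ˣ) (y : Site d) (κ : Fin d)
    (hW : ∀ r : Fin d → Fin L, ‖((Wcx L V₀ (corner L y) κ (boxVec L r) : 𝔸ˣ) : 𝔸) - 1‖ < 1) (c : ℂ) (X : 𝔸) :
    fullCoeff L V₀ y κ (c • X) = c • fullCoeff L V₀ y κ X := by
  unfold fullCoeff
  rw [bondField_smul, B7Prop3GeneralTild.linQcov_smul L V₀ c _ _ κ hW]

/-- … hence it respects differences. [cite: Balaban1985Averaging, (122) p.36] -/
theorem fullCoeff_sub (V₀ : Site d → Fin d → 𝔸ˣ) (y : Site d) (κ : Fin d)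
    (hW : ∀ r : Fin d → Fin L, ‖((Wcx L V₀ (corner L y) κ (boxVec L r) : 𝔸ˣ) : 𝔸) - 1‖ < 1) (X Y : 𝔸) :
    fullCoeff L V₀ y κ (X - Y) = fullCoeff L V₀ y κ X - fullCoeff L V₀ y κ Y := by
  rw [eq_sub_iff_add_eq, ← fullCoeff_add V₀ y κ hW, sub_add_cancel]

/-- **THE FULL COEFFICIENT IS THE MAIN TERM UP TO `O(L²α₀)`**: `‖S(V₀, b₀(c))X − L·S₀(V₀, b₀(c))X‖ ≤ 50(d+1)·ε·L·‖X‖`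
for a background in `U1` whose block loops at `c` satisfy `‖W_x(V₀) − 1‖ ≤ ε ≤ 1/8` — NE7c's explicit (126)
`B7Prop3GeneralLinearBound.norm_linQcov_sub_main_le` («the operators occurring in these terms can be estimated by O(L²α₀)»)
applied to the single-bond field at `b₀(c)`, whose main term is §3's block (`Q0cov_bondField`).
[cite: Balaban1985Averaging, (124)–(126) p.36; Balaban1985UV3, p.271 (after (62))] -/
theorem norm_fullCoeff_sub_smul_mainCoeff_le (hL : 1 ≤ L) {V₀ : Site d → Fin d → 𝔸ˣ} (hV₀ : ∀ x κ, V₀ x κ ∈ U1 𝔸)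
    (y : Site d) (κ : Fin d) {ε : ℝ} (hε0 : 0 ≤ ε) (hε : ε ≤ 1 / 8)
    (hW : ∀ r : Fin d → Fin L, ‖((Wcx L V₀ (corner L y) κ (boxVec L r) : 𝔸ˣ) : 𝔸) - 1‖ ≤ ε) (X : 𝔸) :
    ‖fullCoeff L V₀ y κ X - (L : ℝ) • mainCoeff L V₀ y κ X‖ ≤ 50 * (d + 1) * ε * L * ‖X‖ := by
  unfold fullCoeff
  rw [← Q0cov_bondField hL V₀ y κ X]
  exact B7Prop3GeneralLinearBound.norm_linQcov_sub_main_le L hV₀ (norm_nonneg X)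
    (norm_bondField_le (spineSite L κ y) κ X) hL (corner L y) κ hε0 hε hW

/-- **LOWER BOUND**: `‖S(V₀, b₀(c))X‖ ≥ L·(L^{−d} − 50(d+1)ε)·‖X‖` — the main term `L·L^{−d}` (an isometry, `norm_mainCoeff`)
minus the `O(ε)` corrections. [cite: Balaban1985Averaging, (124)–(126) p.36; Balaban1985UV3, p.271 (after (62))] -/
theorem norm_fullCoeff_ge (hL : 1 ≤ L) {V₀ : Site d → Fin d → 𝔸ˣ} (hV₀ : ∀ x κ, V₀ x κ ∈ U1 𝔸)
    (y : Site d) (κ : Fin d) {ε : ℝ} (hε0 : 0 ≤ ε) (hε : ε ≤ 1 / 8)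
    (hW : ∀ r : Fin d → Fin L, ‖((Wcx L V₀ (corner L y) κ (boxVec L r) : 𝔸ˣ) : 𝔸) - 1‖ ≤ ε) (X : 𝔸) :
    (L : ℝ) * ((((L : ℝ) ^ d)⁻¹) - 50 * (d + 1) * ε) * ‖X‖ ≤ ‖fullCoeff L V₀ y κ X‖ := by
  have h1 := norm_fullCoeff_sub_smul_mainCoeff_le hL hV₀ y κ hε0 hε hW X
  have h2 : ‖(L : ℝ) • mainCoeff L V₀ y κ X‖ = (L : ℝ) * ((((L : ℝ) ^ d)⁻¹) * ‖X‖) := by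
    rw [norm_smul, norm_mainCoeff hL hV₀, Real.norm_of_nonneg (Nat.cast_nonneg L)]
  have h3 := norm_sub_norm_le ((L : ℝ) • mainCoeff L V₀ y κ X) (fullCoeff L V₀ y κ X)
  rw [← norm_neg, neg_sub] at h1
  nlinarith [h1, h2, h3, norm_nonneg X]

/-- **INVERTIBILITY (injectivity) OF THE FULL `b₀(c)`-COEFFICIENT AT A REGULAR BACKGROUND**: if the block loops at `c`
satisfy `‖W_x(V₀) − 1‖ ≤ ε` with `50(d+1)ε < L^{−d}` (and `ε ≤ 1/8`), then `S(V₀, b₀(c))` is injective on the algebra —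
[5] p. 428 «(QB)(c) = 0, considered as an equation on the variable B(b₀)» has at most one solution, for the ACTUAL linear
constraint (not only its main term); on the finite-dimensional 𝔤 this is `det S(V_k^{(k)}, b₀(c)) ≠ 0`, the standing
hypothesis of the elimination (`B10Eq61EliminationTerms`: `hκ`, `hS0`).  The smallness is print's «α₀, α₁ ≤ c₃ … c₃
depends on d and L» of Proposition 3. [cite: Balaban1985BackgroundPropagators, p.428 (after (3.156)); Balaban1985Averaging, Proposition 3 p.36, (126) p.36; Balaban1985UV3, p.271 (after (62))] -/
theorem fullCoeff_injective (hL : 1 ≤ L) {V₀ : Site d → Fin d → 𝔸ˣ} (hV₀ : ∀ x κ, V₀ x κ ∈ U1 𝔸)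
    (y : Site d) (κ : Fin d) {ε : ℝ} (hε0 : 0 ≤ ε) (hε : ε ≤ 1 / 8)
    (hW : ∀ r : Fin d → Fin L, ‖((Wcx L V₀ (corner L y) κ (boxVec L r) : 𝔸ˣ) : 𝔸) - 1‖ ≤ ε)
    (hsmall : 50 * (d + 1) * ε < (((L : ℝ) ^ d)⁻¹)) : Function.Injective (fullCoeff L V₀ y κ) := by
  have hW1 : ∀ r : Fin d → Fin L, ‖((Wcx L V₀ (corner L y) κ (boxVec L r) : 𝔸ˣ) : 𝔸) - 1‖ < 1 :=
    fun r => (hW r).trans_lt (by linarith)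
  have hLpos : (0 : ℝ) < L := by exact_mod_cast hL
  intro X Y h
  have h0 : fullCoeff L V₀ y κ (X - Y) = 0 := by rw [fullCoeff_sub V₀ y κ hW1, h, sub_self]
  have hge := norm_fullCoeff_ge hL hV₀ y κ hε0 hε hW (X - Y)
  rw [h0, norm_zero] at hge
  have hc : 0 < (L : ℝ) * ((((L : ℝ) ^ d)⁻¹) - 50 * (d + 1) * ε) := mul_pos hLpos (by linarith)
  have : ‖X - Y‖ ≤ 0 := by nlinarith [norm_nonneg (X - Y)]
  exact sub_eq_zero.1 (norm_le_zero_iff.1 this)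

/-- **… under the PLAQUETTE regularity (44)/(109)** `|V₀(∂p) − 1| ≤ α₀` for all plaquettes: the block loops are then within
`ε = 16(d+1)(d+4)L²α₀` of `1` (b07's `B7Prop2Explicit.norm_Wcx_sub_one_le`, Proposition 1), so `S(V₀, b₀(c))` is injective
as soon as `512(d+1)(d+4)L²α₀ ≤ 1` and `800(d+1)²(d+4)L²α₀ < L^{−d}` — an explicit `c₃(d, L)`.
[cite: Balaban1985Averaging, (44) p.24, (109) p.34, Proposition 3 p.36; Balaban1985BackgroundPropagators, p.428 (after (3.156)); Balaban1985UV3, p.271 (after (62))] -/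
theorem fullCoeff_injective_of_plaquette (hL : 1 ≤ L) {V₀ : Site d → Fin d → 𝔸ˣ} (hV₀ : ∀ x κ, V₀ x κ ∈ U1 𝔸)
    {α₀ : ℝ} (hα₀ : 0 ≤ α₀) (hsmall₁ : 512 * (d + 1) * (d + 4) * (L : ℝ) ^ 2 * α₀ ≤ 1)
    (hsmall₂ : 800 * (d + 1) ^ 2 * (d + 4) * (L : ℝ) ^ 2 * α₀ < (((L : ℝ) ^ d)⁻¹))
    (h44 : ∀ (x : Site d) (μ ν : Fin d), μ ≠ ν → ‖((hol V₀ x (plaqWord μ ν) : 𝔸ˣ) : 𝔸) - 1‖ ≤ α₀)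
    (y : Site d) (κ : Fin d) : Function.Injective (fullCoeff L V₀ y κ) := by
  have hd : (0 : ℝ) ≤ d := Nat.cast_nonneg d
  have hL2 : (0 : ℝ) ≤ (L : ℝ) ^ 2 := by positivity
  refine fullCoeff_injective hL hV₀ y κ (ε := 2 * (8 * (d + 1) * (d + 4) * (L : ℝ) ^ 2 * α₀)) (by positivity) ?_
    (fun r => B7Prop2Explicit.norm_Wcx_sub_one_le L hL V₀ hV₀ hα₀ hsmall₁ h44 (corner L y) κ r) ?_
  · nlinarith [mul_nonneg (mul_nonneg hd hL2) hα₀]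
  · nlinarith

end Invertibility

/-! ## §9 The determinant on an `Ad`-stable finite-dimensional `𝔤`
([B10] p. 271 «S(V_k^{(k)}, b₀(c)) acting on the Lie algebra 𝔤 … −log det S»; HONEST SCOPE (iii) discharged for the main term) -/

section Folklore

variable {E : Type*} [NormedAddCommGroup E] [NormedSpace ℝ E] [FiniteDimensional ℝ E]

/-- **`|det T| = 1` for a norm-preserving linear endomorphism of a finite-dimensional real normed space — for ANY norm**,
no Euclidean structure needed (Haar measure: `T` maps the unit ball onto itself, and `μ(T·B) = |det T|·μ(B)`).  This is
what lets §3's isometry `norm_mainCoeff` (the algebra norm on 𝔤 ⊂ 𝔸) replace §4's inner-product hypothesis `hT`: linear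
algebra behind print's «−log det S(V_k^{(k)}, b₀(c))», tagged by its locus of use; our proof. [cite: Balaban1985UV3, p.271 (after (62))] -/
theorem abs_det_eq_one_of_norm_map (T : E →ₗ[ℝ] E) (hT : ∀ x, ‖T x‖ = ‖x‖) : |LinearMap.det T| = 1 := by
  borelize E
  set μ : MeasureTheory.Measure E := (Module.finBasis ℝ E).addHaar
  have hinj : Function.Injective T := fun x y h => by
    have h1 : ‖x - y‖ = 0 := by rw [← hT, map_sub, h, sub_self, norm_zero]
    exact sub_eq_zero.1 (norm_eq_zero.1 h1)
  have hsurj : Function.Surjective T := LinearMap.surjective_of_injective hinj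
  have himg : T '' Metric.closedBall (0 : E) 1 = Metric.closedBall 0 1 := by
    ext y
    simp only [Set.mem_image, Metric.mem_closedBall, dist_zero_right]
    constructor
    · rintro ⟨x, hx, rfl⟩
      rwa [hT]
    · intro hy
      obtain ⟨x, rfl⟩ := hsurj y
      exact ⟨x, by rwa [hT] at hy, rfl⟩
  have h := MeasureTheory.Measure.addHaar_image_linearMap μ T (Metric.closedBall 0 1)
  rw [himg] at h
  have hpos : μ (Metric.closedBall (0 : E) 1) ≠ 0 := (Metric.measure_closedBall_pos μ 0 one_pos).ne'
  have hfin : μ (Metric.closedBall (0 : E) 1) ≠ ⊤ := (isCompact_closedBall (0 : E) 1).measure_lt_top.ne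
  have h1 : ENNReal.ofReal |LinearMap.det T| = 1 := by
    refine (ENNReal.mul_right_inj hpos hfin).1 ?_
    rw [mul_one, mul_comm]
    exact h.symm
  exact ENNReal.ofReal_eq_one.1 h1

/-- hence **`|det(t·T)| = |t|^{dim E}`** for a norm-preserving `T` — §4's `abs_det_toMatrix_smul_of_inner` without the
inner product. [cite: Balaban1985UV3, p.271 (after (62))] -/
theorem abs_det_smul_of_norm_map (T : E →ₗ[ℝ] E) (hT : ∀ x, ‖T x‖ = ‖x‖) (t : ℝ) :
    |LinearMap.det (t • T)| = |t| ^ Module.finrank ℝ E := by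
  rw [LinearMap.det_smul, abs_mul, abs_pow, abs_det_eq_one_of_norm_map T hT, mul_one]

/-- and **`|det(R₁ ∘ F ∘ R₂)| = |det F|`** for norm-preserving `R₁`, `R₂` — the mechanism of the gauge invariance of
«−log det S(V_k^{(k)}, b₀(c))» (§6–§7: a gauge transformation conjugates the block by rotations at its two ends).
[cite: Balaban1985UV3, p.271 (after (62)); Balaban1985Averaging, (8) p.18] -/
theorem abs_det_conj_of_norm_map (F R₁ R₂ : E →ₗ[ℝ] E) (h₁ : ∀ x, ‖R₁ x‖ = ‖x‖) (h₂ : ∀ x, ‖R₂ x‖ = ‖x‖) :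
    |LinearMap.det (R₁ ∘ₗ F ∘ₗ R₂)| = |LinearMap.det F| := by
  rw [LinearMap.det_comp, LinearMap.det_comp, abs_mul, abs_mul, abs_det_eq_one_of_norm_map R₁ h₁,
    abs_det_eq_one_of_norm_map R₂ h₂, one_mul, mul_one]

end Folklore

section LieAlgebraDet

variable {𝔸 : Type*} [NormedRing 𝔸] [NormedAlgebra ℂ 𝔸]
variable (L : ℕ)

omit [NormedAlgebra ℂ 𝔸] in
/-- conjugating `W − 1` conjugates `W` ([folklore] algebra; private plumbing). -/
private theorem conjR_sub_one (u W : 𝔸ˣ) : conjR u ((W : 𝔸) - 1) = ((u * W * u⁻¹ : 𝔸ˣ) : 𝔸) - 1 := by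
  rw [conjR_apply, mul_sub, sub_mul, mul_one, Units.mul_inv, Units.val_mul, Units.val_mul]

/-- **the rotation `R(u)` restricted to an `Ad`-stable real subspace `𝔤 ⊂ 𝔸`** («acting on the Lie algebra 𝔤»: the Lie
algebra of the gauge group is stable under the adjoint action of the group; here `𝔤` is ANY real subspace with
`R(u)𝔤 ⊆ 𝔤`), as a real-linear endomorphism of `𝔤`. [cite: Balaban1985UV3, p.271 (after (62)); Balaban1985Averaging, (56)–(57) p.27] -/
def conjROn (𝔤 : Submodule ℝ 𝔸) (u : 𝔸ˣ) (hu : ∀ X ∈ 𝔤, conjR u X ∈ 𝔤) : 𝔤 →ₗ[ℝ] 𝔤 where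
  toFun X := ⟨conjR u X, hu X X.2⟩
  map_add' X Y := Subtype.ext (conjR_add u X Y)
  map_smul' t X := Subtype.ext (conjR_smul_real u t X)

variable {L}

/-- (value of the restricted rotation) [cite: Balaban1985Averaging, (56)–(57) p.27] -/
@[simp] theorem conjROn_apply (𝔤 : Submodule ℝ 𝔸) (u : 𝔸ˣ) (hu : ∀ X ∈ 𝔤, conjR u X ∈ 𝔤) (X : 𝔤) :
    ((conjROn 𝔤 u hu X : 𝔤) : 𝔸) = conjR u X := rfl

/-- `R(u)` is an ISOMETRY of `𝔤` for the algebra norm, `u ∈ U1` (`B8Ineq132.norm_conjR`). [cite: Balaban1985Averaging, (56)–(57) p.27] -/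
theorem norm_conjROn [NormOneClass 𝔸] (𝔤 : Submodule ℝ 𝔸) {u : 𝔸ˣ} (hu1 : u ∈ U1 𝔸) (hu : ∀ X ∈ 𝔤, conjR u X ∈ 𝔤)
    (X : 𝔤) : ‖conjROn 𝔤 u hu X‖ = ‖X‖ := by
  change ‖(conjR u X : 𝔸)‖ = ‖(X : 𝔸)‖
  exact norm_conjR hu1 _

/-- hence **`|det R(u)|_𝔤| = 1`** on a finite-dimensional `Ad`-stable `𝔤` — whatever `u ∈ U1` (§9 `abs_det_eq_one_of_norm_map`).
[cite: Balaban1985UV3, p.271 (after (62)); Balaban1985Averaging, (56)–(57) p.27] -/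
theorem abs_det_conjROn [NormOneClass 𝔸] (𝔤 : Submodule ℝ 𝔸) [FiniteDimensional ℝ 𝔤] {u : 𝔸ˣ} (hu1 : u ∈ U1 𝔸)
    (hu : ∀ X ∈ 𝔤, conjR u X ∈ 𝔤) : |LinearMap.det (conjROn 𝔤 u hu)| = 1 :=
  abs_det_eq_one_of_norm_map _ (norm_conjROn 𝔤 hu1 hu)

variable (L)

/-- **THE MAIN-TERM BLOCK `S₀(V₀, b₀(c))` AS AN ENDOMORPHISM OF `𝔤`**: for a background with values in a subgroup `H ≤ U1`
(in print: the gauge group `G ⊂ U(N)`) and a real subspace `𝔤` stable under every `R(u)`, `u ∈ H` (in print: its Lie algebra,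
`Ad(G)𝔤 = 𝔤`), §3's `X ↦ L^{−d}·R(V₀([c₋, b₀(c)₋]))X` maps `𝔤` into `𝔤` (the transporter is a product of background variables,
`hol_mem_of`).  [v1.5: `H` was `U1 𝔸` itself in v1.3 — second reader's note L-33: the subgroup form covers every compact
`G ⊂ U(N)`, e.g. `SO(N)`, `Sp(n)`, whose Lie algebra is only `Ad(G)`-stable in `M_N(ℂ)`.]
[cite: Balaban1985UV3, p.271 (after (62)); Balaban1985Averaging, (125) p.36] -/
def mainCoeffOn (𝔤 : Submodule ℝ 𝔸) [NormOneClass 𝔸] {H : Subgroup 𝔸ˣ} (hst : ∀ u : 𝔸ˣ, u ∈ H → ∀ X ∈ 𝔤, conjR u X ∈ 𝔤)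
    {V₀ : Site d → Fin d → 𝔸ˣ} (hV₀ : ∀ x κ, V₀ x κ ∈ H) (y : Site d) (κ : Fin d) : 𝔤 →ₗ[ℝ] 𝔤 :=
  (((L : ℝ) ^ d)⁻¹) • conjROn 𝔤 (hol V₀ (corner L y) (seg κ (((L - 1 : ℕ) : ℤ)))) (hst _ (B7Prop2Explicit.hol_mem_of hV₀ _ _))

variable {L}

/-- its value is §3's `mainCoeff`. [cite: Balaban1985Averaging, (125) p.36] -/
@[simp] theorem mainCoeffOn_apply [NormOneClass 𝔸] (𝔤 : Submodule ℝ 𝔸) {H : Subgroup 𝔸ˣ}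
    (hst : ∀ u : 𝔸ˣ, u ∈ H → ∀ X ∈ 𝔤, conjR u X ∈ 𝔤) {V₀ : Site d → Fin d → 𝔸ˣ} (hV₀ : ∀ x κ, V₀ x κ ∈ H)
    (y : Site d) (κ : Fin d) (X : 𝔤) :
    ((mainCoeffOn L 𝔤 hst hV₀ y κ X : 𝔤) : 𝔸) = mainCoeff L V₀ y κ X := by
  rw [mainCoeffOn, LinearMap.smul_apply, Submodule.coe_smul, conjROn_apply, mainCoeff_apply]

/-- **`|det S₀(V₀, b₀(c))|_𝔤 = L^{−d·dim 𝔤}` FOR EVERY BACKGROUND IN `U1`** — the determinant of the main-term block on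
the Lie algebra is BACKGROUND-FREE; this is §4–§5's conclusion with the inner-product hypothesis `hT` REPLACED by the
algebra-norm isometry `norm_mainCoeff` (HONEST SCOPE (iii) of the header discharged for the main term: any finite-
dimensional `Ad`-stable real `𝔤 ⊂ 𝔸` will do). [cite: Balaban1985UV3, p.271 (after (62)), (61) p.271; Balaban1985Averaging, (125) p.36] -/
theorem abs_det_mainCoeffOn [NormOneClass 𝔸] (𝔤 : Submodule ℝ 𝔸) [FiniteDimensional ℝ 𝔤] {H : Subgroup 𝔸ˣ}
    (hH : H ≤ U1 𝔸) (hst : ∀ u : 𝔸ˣ, u ∈ H → ∀ X ∈ 𝔤, conjR u X ∈ 𝔤) {V₀ : Site d → Fin d → 𝔸ˣ}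
    (hV₀ : ∀ x κ, V₀ x κ ∈ H) (y : Site d) (κ : Fin d) :
    |LinearMap.det (mainCoeffOn L 𝔤 hst hV₀ y κ)| = (((L : ℝ) ^ d)⁻¹) ^ Module.finrank ℝ 𝔤 := by
  rw [mainCoeffOn, abs_det_smul_of_norm_map _ (norm_conjROn 𝔤 (hH (B7Prop2Explicit.hol_mem_of hV₀ _ _)) _),
    abs_of_nonneg (by positivity)]

/-- **BACKGROUND-FREENESS**: the two backgrounds of (61) (`U_{k+1}` and `1`, or any two in `U1`, at any two coarse bonds)
give main-term blocks of the SAME `|det|` on `𝔤`. [cite: Balaban1985UV3, (61) p.271] -/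
theorem abs_det_mainCoeffOn_eq [NormOneClass 𝔸] (𝔤 : Submodule ℝ 𝔸) [FiniteDimensional ℝ 𝔤] {H : Subgroup 𝔸ˣ}
    (hH : H ≤ U1 𝔸) (hst : ∀ u : 𝔸ˣ, u ∈ H → ∀ X ∈ 𝔤, conjR u X ∈ 𝔤) {V₀ V₀' : Site d → Fin d → 𝔸ˣ}
    (hV₀ : ∀ x κ, V₀ x κ ∈ H) (hV₀' : ∀ x κ, V₀' x κ ∈ H) (y y' : Site d) (κ κ' : Fin d) :
    |LinearMap.det (mainCoeffOn L 𝔤 hst hV₀ y κ)| = |LinearMap.det (mainCoeffOn L 𝔤 hst hV₀' y' κ')| := by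
  rw [abs_det_mainCoeffOn 𝔤 hH, abs_det_mainCoeffOn 𝔤 hH]

/-- **the local term of p. 271 FOR THE MAIN TERM is the constant `d·dim 𝔤·log L`**: `−log|det S₀(V₀, b₀(c))|_𝔤 =
d·dim 𝔤·log L`, the same number at every coarse bond and every background. [cite: Balaban1985UV3, p.271 (after (62))] -/
theorem neg_log_abs_det_mainCoeffOn [NormOneClass 𝔸] (hL : 1 ≤ L) (𝔤 : Submodule ℝ 𝔸) [FiniteDimensional ℝ 𝔤]
    {H : Subgroup 𝔸ˣ} (hH : H ≤ U1 𝔸) (hst : ∀ u : 𝔸ˣ, u ∈ H → ∀ X ∈ 𝔤, conjR u X ∈ 𝔤)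
    {V₀ : Site d → Fin d → 𝔸ˣ} (hV₀ : ∀ x κ, V₀ x κ ∈ H) (y : Site d) (κ : Fin d) :
    -Real.log |LinearMap.det (mainCoeffOn L 𝔤 hst hV₀ y κ)| = d * Module.finrank ℝ 𝔤 * Real.log L := by
  have hLpos : (0 : ℝ) < L := by exact_mod_cast hL
  rw [abs_det_mainCoeffOn 𝔤 hH, Real.log_pow, Real.log_inv, Real.log_pow]
  ring

/-- In COORDINATES (any basis `b` of `𝔤`): the matrix of the main-term block has `|det| = L^{−d·dim 𝔤}` — the block
`S c` which §5 / `B10Eq61EliminationTerms` consume. [cite: Balaban1985UV3, p.271 (after (62))] -/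
theorem abs_det_toMatrix_mainCoeffOn [NormOneClass 𝔸] (𝔤 : Submodule ℝ 𝔸) [FiniteDimensional ℝ 𝔤]
    {ι : Type*} [Fintype ι] [DecidableEq ι] (b : Module.Basis ι ℝ 𝔤) {H : Subgroup 𝔸ˣ} (hH : H ≤ U1 𝔸)
    (hst : ∀ u : 𝔸ˣ, u ∈ H → ∀ X ∈ 𝔤, conjR u X ∈ 𝔤) {V₀ : Site d → Fin d → 𝔸ˣ} (hV₀ : ∀ x κ, V₀ x κ ∈ H)
    (y : Site d) (κ : Fin d) :
    |(LinearMap.toMatrix b b (mainCoeffOn L 𝔤 hst hV₀ y κ)).det| = (((L : ℝ) ^ d)⁻¹) ^ Fintype.card ι := by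
  rw [LinearMap.det_toMatrix, abs_det_mainCoeffOn 𝔤 hH, Module.finrank_eq_card_basis b]

end LieAlgebraDet

section BracketOnLie

variable {o dd : Type*} [Fintype o] [DecidableEq o] [Fintype dd] [DecidableEq dd]

/-- §5 with the shape hypothesis weakened to what it uses: blockwise EQUAL `|det|` gives assemblies of equal `|det|`.
[cite: Balaban1985UV3, (61) p.271] -/
theorem abs_det_eq_of_blocks {m : ℕ} (Q₁ Q₀ : Matrix (Fin m) (Fin m) ℝ) (em : Fin m ≃ dd × o)
    (S₁ S₀ : o → Matrix dd dd ℝ)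
    (hS₁ : Matrix.reindex em em Q₁ = Matrix.blockDiagonal S₁) (hS₀ : Matrix.reindex em em Q₀ = Matrix.blockDiagonal S₀)
    (h : ∀ c, |(S₁ c).det| = |(S₀ c).det|) : |Q₁.det| = |Q₀.det| := by
  rw [← Matrix.det_reindex_self em Q₁, ← Matrix.det_reindex_self em Q₀, hS₁, hS₀,
    Beta.ConstraintElimination.abs_det_blockDiagonal, Beta.ConstraintElimination.abs_det_blockDiagonal]
  exact prod_congr rfl fun c _ => h c

variable {𝔸 : Type*} [NormedRing 𝔸] [NormedAlgebra ℂ 𝔸] [NormOneClass 𝔸]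
variable {L : ℕ}

open MeasureTheory B10Eq55GaussianStep B10Eq61EliminationTerms in
/-- **(61) WITH MAIN-TERM BLOCKS ON THE LIE ALGEBRA — NO SHAPE HYPOTHESIS LEFT**: if the `κ`-blocks of the two constrained
normalisations of (61) are block-diagonal over the coarse bonds `c ∈ o` with blocks THE MATRICES (in a basis `b` of a
finite-dimensional `Ad`-stable `𝔤`) of the main-term blocks `S₀(U_{k+1}, b₀(c))`, `S₀(1, b₀(c))` at the coarse bonds
`(y c, κ c)`, then — both backgrounds lying in `U1` — the local terms cancel and `log Z^{(k)}(·, U_{k+1}) − log Z^{(k)}(·, 1)`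
IS the Gaussian bracket: §5's `logZ_sub_logZ_eq_of_mainTerm_shape` with its hypotheses `h₁`/`h₀` DISCHARGED by §9.  (For
the full (124) blocks `S = S₀(1 + O(L²α₀))` the local terms do NOT cancel; they are gauge invariant, §9c.)
[cite: Balaban1985UV3, (61) p.271, p.271 (after (62))] -/
theorem logZ_sub_logZ_eq_of_mainCoeffOn_blocks (𝔤 : Submodule ℝ 𝔸) [FiniteDimensional ℝ 𝔤]
    {ι : Type*} [Fintype ι] [DecidableEq ι] (b : Module.Basis ι ℝ 𝔤) {H : Subgroup 𝔸ˣ} (hH : H ≤ U1 𝔸)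
    (hst : ∀ u : 𝔸ˣ, u ∈ H → ∀ X ∈ 𝔤, conjR u X ∈ 𝔤) {U V : Site d → Fin d → 𝔸ˣ}
    (hU : ∀ x κ, U x κ ∈ H) (hV : ∀ x κ, V x κ ∈ H) (yc : o → Site d) (κc : o → Fin d)
    {n m r : ℕ} (Z₁ Z₀ : Beta.ConstrainedGaussian n m) (e₁ e₀ : Fin n ≃ Fin r ⊕ Fin m) (em : Fin m ≃ ι × o)
    (hS₁ : Matrix.reindex em em (Z₁.constraintEliminated e₁)
      = Matrix.blockDiagonal fun c => LinearMap.toMatrix b b (mainCoeffOn L 𝔤 hst hU (yc c) (κc c)))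
    (hS₀ : Matrix.reindex em em (Z₀.constraintEliminated e₀)
      = Matrix.blockDiagonal fun c => LinearMap.toMatrix b b (mainCoeffOn L 𝔤 hst hV (yc c) (κc c)))
    (hκ₁ : (Z₁.constraintEliminated e₁).det ≠ 0) (hκ₀ : (Z₀.constraintEliminated e₀).det ≠ 0)
    (hC₁ : (Z₁.reduced (Z₁.elimMatrix e₁)).PosDef) (hC₀ : (Z₀.reduced (Z₀.elimMatrix e₀)).PosDef) :
    Z₁.logZ - Z₀.logZ
      = Real.log (Zk (volume : Measure (Fin r → ℝ)) (Matrix.toLinearMap₂' ℝ (Z₁.reduced (Z₁.elimMatrix e₁))))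
        - Real.log (Zk (volume : Measure (Fin r → ℝ)) (Matrix.toLinearMap₂' ℝ (Z₀.reduced (Z₀.elimMatrix e₀)))) :=
  logZ_sub_logZ_eq_of_abs_det_eq Z₁ Z₀ e₁ e₀ hκ₁ hκ₀ hC₁ hC₀
    (abs_det_eq_of_blocks _ _ em _ _ hS₁ hS₀ fun c => by
      rw [abs_det_toMatrix_mainCoeffOn 𝔤 b hH, abs_det_toMatrix_mainCoeffOn 𝔤 b hH])

end BracketOnLie

/-! ## §9c Gauge invariance of `|det S(V_k^{(k)}, b₀(c))|_𝔤` for the FULL coefficient («gauge invariant functions of V_k^{(k)}», p. 271) -/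

section GaugeDet

variable {𝔸 : Type*} [NormedRing 𝔸] [NormedAlgebra ℂ 𝔸] [NormOneClass 𝔸] [CompleteSpace 𝔸]
variable {L : ℕ}

omit [NormedAlgebra ℂ 𝔸] [CompleteSpace 𝔸] in
/-- the block-loop regularity `‖W_x(V₀) − 1‖ < 1` is GAUGE INVARIANT (`Wcx_gaugeAct`: the loop variable is conjugated,
(45) of [4]). [cite: Balaban1985Averaging, (45) p.24, (8) p.18] -/
theorem norm_Wcx_gaugeAct_sub_one {u : Site d → 𝔸ˣ} (hu : ∀ x, u x ∈ U1 𝔸) (V₀ : Site d → Fin d → 𝔸ˣ)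
    (q : Site d) (κ : Fin d) (r : Site d) :
    ‖((Wcx L (gaugeAct u V₀) q κ r : 𝔸ˣ) : 𝔸) - 1‖ = ‖((Wcx L V₀ q κ r : 𝔸ˣ) : 𝔸) - 1‖ := by
  rw [Wcx_gaugeAct, ← conjR_sub_one, norm_conjR (hu q)]

omit [NormOneClass 𝔸] in
/-- if `S(V₀, b₀(c))` maps `𝔤` into `𝔤`, so does `S(V₀^u, b₀(c))` for a `U1`-valued gauge transformation `u` and an
`Ad`-stable `𝔤` (§7 `fullCoeff_gaugeAct'`). [cite: Balaban1985UV3, p.271 (after (62)); Balaban1985Averaging, (8) p.18] -/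
theorem fullCoeff_gaugeAct_mem (𝔤 : Submodule ℝ 𝔸) {H : Subgroup 𝔸ˣ} (hst : ∀ u : 𝔸ˣ, u ∈ H → ∀ X ∈ 𝔤, conjR u X ∈ 𝔤)
    {u : Site d → 𝔸ˣ} (hu : ∀ x, u x ∈ H) (V₀ : Site d → Fin d → 𝔸ˣ) (y : Site d) (κ : Fin d)
    (h𝔤 : ∀ X ∈ 𝔤, fullCoeff L V₀ y κ X ∈ 𝔤) : ∀ X ∈ 𝔤, fullCoeff L (gaugeAct u V₀) y κ X ∈ 𝔤 := fun X hX => by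
  rw [fullCoeff_gaugeAct']
  exact hst _ (hu _) _ (h𝔤 _ (hst _ (H.inv_mem (hu _)) _ hX))

variable (L)

/-- **THE FULL COEFFICIENT `S(V₀, b₀(c))` AS A REAL-LINEAR ENDOMORPHISM OF `𝔤`** at a background whose block loops at `c`
satisfy `‖W_x(V₀) − 1‖ < 1` (linearity, §8) — UNDER THE HYPOTHESIS `h𝔤` that it maps `𝔤` into `𝔤` (print: «a linear
operator S(V_k^{(k)}, b₀(c)) acting on the Lie algebra 𝔤»; on the lineage's abstract algebra `𝔸` this is not derived —
it would follow from the group-valuedness of the averaging (121), not typed). [cite: Balaban1985UV3, p.271 (after (62)); Balaban1985Averaging, (122), (124) p.36] -/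
def fullCoeffOn (𝔤 : Submodule ℝ 𝔸) (V₀ : Site d → Fin d → 𝔸ˣ) (y : Site d) (κ : Fin d)
    (hW : ∀ r : Fin d → Fin L, ‖((Wcx L V₀ (corner L y) κ (boxVec L r) : 𝔸ˣ) : 𝔸) - 1‖ < 1)
    (h𝔤 : ∀ X ∈ 𝔤, fullCoeff L V₀ y κ X ∈ 𝔤) : 𝔤 →ₗ[ℝ] 𝔤 where
  toFun X := ⟨fullCoeff L V₀ y κ X, h𝔤 X X.2⟩
  map_add' X Y := Subtype.ext (fullCoeff_add V₀ y κ hW X Y)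
  map_smul' t X := Subtype.ext (by
    change fullCoeff L V₀ y κ ((t : ℝ) • (X : 𝔸)) = (t : ℝ) • fullCoeff L V₀ y κ X
    rw [← Complex.coe_smul, fullCoeff_smul V₀ y κ hW, Complex.coe_smul])

variable {L}

/-- (value of the restricted full coefficient) [cite: Balaban1985Averaging, (122) p.36] -/
@[simp] theorem fullCoeffOn_apply (𝔤 : Submodule ℝ 𝔸) (V₀ : Site d → Fin d → 𝔸ˣ) (y : Site d) (κ : Fin d)
    (hW : ∀ r : Fin d → Fin L, ‖((Wcx L V₀ (corner L y) κ (boxVec L r) : 𝔸ˣ) : 𝔸) - 1‖ < 1)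
    (h𝔤 : ∀ X ∈ 𝔤, fullCoeff L V₀ y κ X ∈ 𝔤) (X : 𝔤) :
    ((fullCoeffOn L 𝔤 V₀ y κ hW h𝔤 X : 𝔤) : 𝔸) = fullCoeff L V₀ y κ X := rfl

/-- **`S(V₀^u, b₀(c)) = R(u(c₋)) ∘ S(V₀, b₀(c)) ∘ R(u(b₀(c)₋))⁻¹` ON `𝔤`** (§7 `fullCoeff_gaugeAct'`, restricted).
[cite: Balaban1985UV3, p.271 (after (62)); Balaban1985BackgroundPropagators, (3.32) p.395; Balaban1985Averaging, (8) p.18] -/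
theorem fullCoeffOn_gaugeAct (𝔤 : Submodule ℝ 𝔸) {H : Subgroup 𝔸ˣ} (hst : ∀ u : 𝔸ˣ, u ∈ H → ∀ X ∈ 𝔤, conjR u X ∈ 𝔤)
    {u : Site d → 𝔸ˣ} (hu : ∀ x, u x ∈ H) (V₀ : Site d → Fin d → 𝔸ˣ) (y : Site d) (κ : Fin d)
    (hW : ∀ r : Fin d → Fin L, ‖((Wcx L V₀ (corner L y) κ (boxVec L r) : 𝔸ˣ) : 𝔸) - 1‖ < 1)
    (h𝔤 : ∀ X ∈ 𝔤, fullCoeff L V₀ y κ X ∈ 𝔤)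
    (hWu : ∀ r : Fin d → Fin L, ‖((Wcx L (gaugeAct u V₀) (corner L y) κ (boxVec L r) : 𝔸ˣ) : 𝔸) - 1‖ < 1)
    (h𝔤u : ∀ X ∈ 𝔤, fullCoeff L (gaugeAct u V₀) y κ X ∈ 𝔤) :
    fullCoeffOn L 𝔤 (gaugeAct u V₀) y κ hWu h𝔤u
      = conjROn 𝔤 (u (corner L y)) (hst _ (hu _))
          ∘ₗ fullCoeffOn L 𝔤 V₀ y κ hW h𝔤 ∘ₗ conjROn 𝔤 (u (spineSite L κ y))⁻¹ (hst _ (H.inv_mem (hu _))) := by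
  ext X
  simp only [LinearMap.coe_comp, Function.comp_apply, fullCoeffOn_apply, conjROn_apply]
  exact fullCoeff_gaugeAct' u V₀ y κ X

/-- **`|det S(V_k^{(k)}, b₀(c))|_𝔤 IS A GAUGE INVARIANT FUNCTION OF THE BACKGROUND** — print's «simple, local, gauge
invariant functions of V_k^{(k)}» for the local term `−log|det S|` of the ACTUAL coefficient (not only its main term): the
hypotheses on `V₀` alone (block-loop regularity at `c`, `𝔤`-stability of `S(V₀, b₀(c))`), their gauge transforms being
derived (`norm_Wcx_gaugeAct_sub_one`, `fullCoeff_gaugeAct_mem`). [cite: Balaban1985UV3, p.271 (after (62)); Balaban1985Averaging, (8) p.18, (45) p.24] -/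
theorem abs_det_fullCoeffOn_gaugeAct (𝔤 : Submodule ℝ 𝔸) [FiniteDimensional ℝ 𝔤] {H : Subgroup 𝔸ˣ}
    (hH : H ≤ U1 𝔸) (hst : ∀ u : 𝔸ˣ, u ∈ H → ∀ X ∈ 𝔤, conjR u X ∈ 𝔤)
    {u : Site d → 𝔸ˣ} (hu : ∀ x, u x ∈ H) (V₀ : Site d → Fin d → 𝔸ˣ) (y : Site d) (κ : Fin d)
    (hW : ∀ r : Fin d → Fin L, ‖((Wcx L V₀ (corner L y) κ (boxVec L r) : 𝔸ˣ) : 𝔸) - 1‖ < 1)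
    (h𝔤 : ∀ X ∈ 𝔤, fullCoeff L V₀ y κ X ∈ 𝔤) :
    |LinearMap.det (fullCoeffOn L 𝔤 (gaugeAct u V₀) y κ
        (fun r => (norm_Wcx_gaugeAct_sub_one (fun x => hH (hu x)) V₀ _ κ _).trans_lt (hW r))
        (fullCoeff_gaugeAct_mem 𝔤 hst hu V₀ y κ h𝔤))|
      = |LinearMap.det (fullCoeffOn L 𝔤 V₀ y κ hW h𝔤)| := by
  rw [fullCoeffOn_gaugeAct 𝔤 hst hu V₀ y κ hW h𝔤,
    abs_det_conj_of_norm_map _ _ _ (norm_conjROn 𝔤 (hH (hu _)) _) (norm_conjROn 𝔤 (hH (H.inv_mem (hu _))) _)]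

/-- … so **the local term `−log|det S(V_k^{(k)}, b₀(c))|_𝔤` is gauge invariant**. [cite: Balaban1985UV3, p.271 (after (62))] -/
theorem neg_log_abs_det_fullCoeffOn_gaugeAct (𝔤 : Submodule ℝ 𝔸) [FiniteDimensional ℝ 𝔤] {H : Subgroup 𝔸ˣ}
    (hH : H ≤ U1 𝔸) (hst : ∀ u : 𝔸ˣ, u ∈ H → ∀ X ∈ 𝔤, conjR u X ∈ 𝔤)
    {u : Site d → 𝔸ˣ} (hu : ∀ x, u x ∈ H) (V₀ : Site d → Fin d → 𝔸ˣ) (y : Site d) (κ : Fin d)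
    (hW : ∀ r : Fin d → Fin L, ‖((Wcx L V₀ (corner L y) κ (boxVec L r) : 𝔸ˣ) : 𝔸) - 1‖ < 1)
    (h𝔤 : ∀ X ∈ 𝔤, fullCoeff L V₀ y κ X ∈ 𝔤) :
    -Real.log |LinearMap.det (fullCoeffOn L 𝔤 (gaugeAct u V₀) y κ
        (fun r => (norm_Wcx_gaugeAct_sub_one (fun x => hH (hu x)) V₀ _ κ _).trans_lt (hW r))
        (fullCoeff_gaugeAct_mem 𝔤 hst hu V₀ y κ h𝔤))|
      = -Real.log |LinearMap.det (fullCoeffOn L 𝔤 V₀ y κ hW h𝔤)| := by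
  rw [abs_det_fullCoeffOn_gaugeAct 𝔤 hH hst hu V₀ y κ hW h𝔤]

end GaugeDet

/-! ## §9d On `𝔤` the `b₀(c)`-equation is uniquely SOLVABLE and `det S(V_k^{(k)}, b₀(c)) ≠ 0`
([5] p. 428 «(CB̃)(b₀) is equal to a solution of the equation (QB)(c) = 0»; second reader's note L-32 (e)) -/

section DetNeZero

variable {𝔸 : Type*} [NormedRing 𝔸] [NormedAlgebra ℂ 𝔸] [NormOneClass 𝔸] [CompleteSpace 𝔸]
variable {L : ℕ}

/-- **`S(V₀, b₀(c))|_𝔤` IS INJECTIVE** at a regular background (block loops within `ε ≤ 1/8` of `1`, `50(d+1)ε < L^{−d}`):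
§8's `fullCoeff_injective` restricted to the `S`-stable `𝔤`. [cite: Balaban1985BackgroundPropagators, p.428 (after (3.156)); Balaban1985UV3, p.271 (after (62))] -/
theorem fullCoeffOn_injective (hL : 1 ≤ L) (𝔤 : Submodule ℝ 𝔸) {V₀ : Site d → Fin d → 𝔸ˣ}
    (hV₀ : ∀ x κ, V₀ x κ ∈ U1 𝔸) (y : Site d) (κ : Fin d) {ε : ℝ} (hε0 : 0 ≤ ε) (hε : ε ≤ 1 / 8)
    (hW : ∀ r : Fin d → Fin L, ‖((Wcx L V₀ (corner L y) κ (boxVec L r) : 𝔸ˣ) : 𝔸) - 1‖ ≤ ε)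
    (hsmall : 50 * (d + 1) * ε < (((L : ℝ) ^ d)⁻¹))
    (hW1 : ∀ r : Fin d → Fin L, ‖((Wcx L V₀ (corner L y) κ (boxVec L r) : 𝔸ˣ) : 𝔸) - 1‖ < 1)
    (h𝔤 : ∀ X ∈ 𝔤, fullCoeff L V₀ y κ X ∈ 𝔤) :
    Function.Injective (fullCoeffOn L 𝔤 V₀ y κ hW1 h𝔤) := fun _ _ h =>
  Subtype.ext (fullCoeff_injective hL hV₀ y κ hε0 hε hW hsmall (congrArg Subtype.val h))

/-- **… HENCE BIJECTIVE on the finite-dimensional `𝔤`**: for every right-hand side the `b₀(c)`-equation has EXACTLY ONE solution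
in `𝔤` — [5] p. 428's «a solution of the equation (QB)(c) = 0, considered as an equation on the variable B(b₀)» EXISTS and is
unique, for the ACTUAL linear constraint at a regular background (finite dimension: injective ⇒ surjective).
[cite: Balaban1985BackgroundPropagators, p.428 (after (3.156)); Balaban1985UV3, p.271 (after (62))] -/
theorem fullCoeffOn_bijective (hL : 1 ≤ L) (𝔤 : Submodule ℝ 𝔸) [FiniteDimensional ℝ 𝔤] {V₀ : Site d → Fin d → 𝔸ˣ}
    (hV₀ : ∀ x κ, V₀ x κ ∈ U1 𝔸) (y : Site d) (κ : Fin d) {ε : ℝ} (hε0 : 0 ≤ ε) (hε : ε ≤ 1 / 8)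
    (hW : ∀ r : Fin d → Fin L, ‖((Wcx L V₀ (corner L y) κ (boxVec L r) : 𝔸ˣ) : 𝔸) - 1‖ ≤ ε)
    (hsmall : 50 * (d + 1) * ε < (((L : ℝ) ^ d)⁻¹))
    (hW1 : ∀ r : Fin d → Fin L, ‖((Wcx L V₀ (corner L y) κ (boxVec L r) : 𝔸ˣ) : 𝔸) - 1‖ < 1)
    (h𝔤 : ∀ X ∈ 𝔤, fullCoeff L V₀ y κ X ∈ 𝔤) :
    Function.Bijective (fullCoeffOn L 𝔤 V₀ y κ hW1 h𝔤) :=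
  have hinj := fullCoeffOn_injective hL 𝔤 hV₀ y κ hε0 hε hW hsmall hW1 h𝔤
  ⟨hinj, LinearMap.surjective_of_injective hinj⟩

/-- the same as print's sentence: **for every `w` there is exactly one `X ∈ 𝔤` with `S(V₀, b₀(c))X = w`**.
[cite: Balaban1985BackgroundPropagators, p.428 (after (3.156))] -/
theorem fullCoeffOn_existsUnique (hL : 1 ≤ L) (𝔤 : Submodule ℝ 𝔸) [FiniteDimensional ℝ 𝔤] {V₀ : Site d → Fin d → 𝔸ˣ}
    (hV₀ : ∀ x κ, V₀ x κ ∈ U1 𝔸) (y : Site d) (κ : Fin d) {ε : ℝ} (hε0 : 0 ≤ ε) (hε : ε ≤ 1 / 8)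
    (hW : ∀ r : Fin d → Fin L, ‖((Wcx L V₀ (corner L y) κ (boxVec L r) : 𝔸ˣ) : 𝔸) - 1‖ ≤ ε)
    (hsmall : 50 * (d + 1) * ε < (((L : ℝ) ^ d)⁻¹))
    (hW1 : ∀ r : Fin d → Fin L, ‖((Wcx L V₀ (corner L y) κ (boxVec L r) : 𝔸ˣ) : 𝔸) - 1‖ < 1)
    (h𝔤 : ∀ X ∈ 𝔤, fullCoeff L V₀ y κ X ∈ 𝔤) (w : 𝔤) :
    ∃! X : 𝔤, fullCoeffOn L 𝔤 V₀ y κ hW1 h𝔤 X = w :=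
  (fullCoeffOn_bijective hL 𝔤 hV₀ y κ hε0 hε hW hsmall hW1 h𝔤).existsUnique w

/-- **`det S(V_k^{(k)}, b₀(c)) ≠ 0` ON `𝔤`** — the standing hypothesis `hκ`/`hS0` of the elimination
(`B10Eq61EliminationTerms`, «−log det S») DISCHARGED for the actual coefficient at a regular background, on any
finite-dimensional `S`-stable real `𝔤` (the v1.2 HONEST SCOPE clause «det ≠ 0 on 𝔤 proper … not typed» closed, modulo the
`S`-stability hypothesis `h𝔤`). [cite: Balaban1985UV3, p.271 (after (62)); Balaban1985BackgroundPropagators, p.428 (after (3.156))] -/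
theorem det_fullCoeffOn_ne_zero (hL : 1 ≤ L) (𝔤 : Submodule ℝ 𝔸) [FiniteDimensional ℝ 𝔤] {V₀ : Site d → Fin d → 𝔸ˣ}
    (hV₀ : ∀ x κ, V₀ x κ ∈ U1 𝔸) (y : Site d) (κ : Fin d) {ε : ℝ} (hε0 : 0 ≤ ε) (hε : ε ≤ 1 / 8)
    (hW : ∀ r : Fin d → Fin L, ‖((Wcx L V₀ (corner L y) κ (boxVec L r) : 𝔸ˣ) : 𝔸) - 1‖ ≤ ε)
    (hsmall : 50 * (d + 1) * ε < (((L : ℝ) ^ d)⁻¹))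
    (hW1 : ∀ r : Fin d → Fin L, ‖((Wcx L V₀ (corner L y) κ (boxVec L r) : 𝔸ˣ) : 𝔸) - 1‖ < 1)
    (h𝔤 : ∀ X ∈ 𝔤, fullCoeff L V₀ y κ X ∈ 𝔤) :
    LinearMap.det (fullCoeffOn L 𝔤 V₀ y κ hW1 h𝔤) ≠ 0 := by
  have hinj := fullCoeffOn_injective hL 𝔤 hV₀ y κ hε0 hε hW hsmall hW1 h𝔤
  have hu : IsUnit (fullCoeffOn L 𝔤 V₀ y κ hW1 h𝔤) :=
    (LinearMap.isUnit_iff_ker_eq_bot _).2 (LinearMap.ker_eq_bot.2 hinj)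
  exact (LinearMap.isUnit_det _ hu).ne_zero

/-- hence **the local term `−log|det S(V_k^{(k)}, b₀(c))|_𝔤` is the logarithm of a POSITIVE number** (`|det| > 0`; the sign
of `det` itself is not asserted). [cite: Balaban1985UV3, p.271 (after (62))] -/
theorem abs_det_fullCoeffOn_pos (hL : 1 ≤ L) (𝔤 : Submodule ℝ 𝔸) [FiniteDimensional ℝ 𝔤] {V₀ : Site d → Fin d → 𝔸ˣ}
    (hV₀ : ∀ x κ, V₀ x κ ∈ U1 𝔸) (y : Site d) (κ : Fin d) {ε : ℝ} (hε0 : 0 ≤ ε) (hε : ε ≤ 1 / 8)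
    (hW : ∀ r : Fin d → Fin L, ‖((Wcx L V₀ (corner L y) κ (boxVec L r) : 𝔸ˣ) : 𝔸) - 1‖ ≤ ε)
    (hsmall : 50 * (d + 1) * ε < (((L : ℝ) ^ d)⁻¹))
    (hW1 : ∀ r : Fin d → Fin L, ‖((Wcx L V₀ (corner L y) κ (boxVec L r) : 𝔸ˣ) : 𝔸) - 1‖ < 1)
    (h𝔤 : ∀ X ∈ 𝔤, fullCoeff L V₀ y κ X ∈ 𝔤) :
    0 < |LinearMap.det (fullCoeffOn L 𝔤 V₀ y κ hW1 h𝔤)| :=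
  abs_pos.2 (det_fullCoeffOn_ne_zero hL 𝔤 hV₀ y κ hε0 hε hW hsmall hW1 h𝔤)

/-- **AN EXPLICIT «c₃(d, L)» OF PROPOSITION 3 FOR THE INVERTIBILITY**: under the plaquette regularity (44)/(109)
`|V₀(∂p) − 1| ≤ α₀` with the single window `α₀ < L^{−(d+2)}/(800(d+1)²(d+4))`, the full coefficient is injective on the
algebra (§8's two conditions follow: `512(d+1)(d+4)L²α₀ ≤ 800(d+1)²(d+4)L²α₀ < L^{−d} ≤ 1`; second reader's note L-32 (f)).
[cite: Balaban1985Averaging, Proposition 3 p.36 («c₃ depends on d and L»), (44) p.24, (109) p.34; Balaban1985BackgroundPropagators, p.428 (after (3.156))] -/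
theorem fullCoeff_injective_of_c3 (hL : 1 ≤ L) {V₀ : Site d → Fin d → 𝔸ˣ} (hV₀ : ∀ x κ, V₀ x κ ∈ U1 𝔸)
    {α₀ : ℝ} (hα₀ : 0 ≤ α₀) (hc3 : α₀ < ((L : ℝ) ^ (d + 2) * (800 * (d + 1) ^ 2 * (d + 4)))⁻¹)
    (h44 : ∀ (x : Site d) (μ ν : Fin d), μ ≠ ν → ‖((hol V₀ x (plaqWord μ ν) : 𝔸ˣ) : 𝔸) - 1‖ ≤ α₀)
    (y : Site d) (κ : Fin d) : Function.Injective (fullCoeff L V₀ y κ) := by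
  have hLpos : (0 : ℝ) < L := by exact_mod_cast hL
  have hL1 : (1 : ℝ) ≤ L := by exact_mod_cast hL
  have hd : (0 : ℝ) ≤ d := Nat.cast_nonneg d
  have hK : (0 : ℝ) < 800 * (d + 1) ^ 2 * (d + 4) := by positivity
  have hLd2 : (0 : ℝ) < (L : ℝ) ^ (d + 2) := by positivity
  -- the second §8 condition is `hc3` rearranged
  have hsmall₂ : 800 * (d + 1) ^ 2 * (d + 4) * (L : ℝ) ^ 2 * α₀ < (((L : ℝ) ^ d)⁻¹) := by
    have h1 := mul_lt_mul_of_pos_left hc3 (mul_pos hK (pow_pos hLpos 2))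
    have h2 : 800 * (d + 1) ^ 2 * (d + 4) * (L : ℝ) ^ 2 * ((L : ℝ) ^ (d + 2) * (800 * (d + 1) ^ 2 * (d + 4)))⁻¹
        = (((L : ℝ) ^ d)⁻¹) := by
      field_simp
      ring
    calc 800 * (d + 1) ^ 2 * (d + 4) * (L : ℝ) ^ 2 * α₀
        = 800 * (d + 1) ^ 2 * (d + 4) * (L : ℝ) ^ 2 * α₀ := rfl
      _ < 800 * (d + 1) ^ 2 * (d + 4) * (L : ℝ) ^ 2 * ((L : ℝ) ^ (d + 2) * (800 * (d + 1) ^ 2 * (d + 4)))⁻¹ := h1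
      _ = (((L : ℝ) ^ d)⁻¹) := h2
  -- the first follows since `512 ≤ 800(d+1)` and `L^{−d} ≤ 1`
  have hinv1 : (((L : ℝ) ^ d)⁻¹) ≤ 1 := inv_le_one_of_one_le₀ (one_le_pow₀ hL1)
  have hsmall₁ : 512 * (d + 1) * (d + 4) * (L : ℝ) ^ 2 * α₀ ≤ 1 := by
    have hmono : 512 * (d + 1) * (d + 4) * (L : ℝ) ^ 2 * α₀ ≤ 800 * (d + 1) ^ 2 * (d + 4) * (L : ℝ) ^ 2 * α₀ := by
      have : (512 : ℝ) * (d + 1) ≤ 800 * (d + 1) ^ 2 := by nlinarith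
      have hrest : (0 : ℝ) ≤ (d + 4) * (L : ℝ) ^ 2 * α₀ := by positivity
      nlinarith
    linarith
  exact fullCoeff_injective_of_plaquette hL hV₀ hα₀ hsmall₁ hsmall₂ h44 y κ

end DetNeZero

end Literature.MathematicalPhysics.QuantumFieldTheory.Balaban1983to89.B10Eq61SpineCoefficient

end
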